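import Literature.NumberTheory.EllipticCurves.GrossPointsThetaElement
import Literature.NumberTheory.EllipticCurves.HeegnerPointsImaginaryQuadraticProofs
import Literature.NumberTheory.QuadraticFields.LatticeSumPrincipal
import HarnessLib

/-!
# The tower of Picard groups `Pic(𝒪_{cp}) → Pic(𝒪_c)` of quadratic orders (`p ∣ c`):
# surjectivity and the kernel of order `p` (Bertolini–Darmon 1996 §2.3, Cox §7.D)

Topic `NumberTheory/EllipticCurves` (sequel of `GrossPoints.lean`, `GrossPointsPicardAction.lean`,
`GrossPointsThetaElement.lean`, which define the orders `quadOrder K c = ℤ + c𝓞_K`, their Picard groups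
`ClassGroup (quadOrder K c)` and the restriction maps `picRes : Pic(𝒪_d) → Pic(𝒪_c)`, `c ∣ d`).
DEFINITIONS with proved API and THEOREMS only: no named fact, no `sorry`, no instance, no notation.

For an imaginary quadratic field `K`, a prime `p` and a conductor `c` with `p ∣ c`, write
`𝒪 = 𝒪_c = ℤ + c𝓞_K` and `𝒪' = 𝒪_{cp} = ℤ + p𝒪`. Bertolini–Darmon, *Heegner points on Mumford–Tate
curves*, Invent. Math. 126 (1996), §2.3 (p. 432): "Let `G_n = Pic(𝒪_n)` … The group `Gal(K_n/K_0)` is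
canonically isomorphic to `(𝒪_K ⊗ ℤ/pⁿℤ)^× / (ℤ/pⁿℤ)^×`" (up to the units of `𝒪_K`), so that for `n ≥ 1`
the layer `Gal(K_{n+1}/K_n) = ker(G_{n+1} → G_n)` is cyclic of order `p`; Cox, *Primes of the form
x² + ny²*, §7.D, (7.25)–(7.27) (the exact sequence `1 → (𝒪/p𝒪)^×/(𝒪'/p𝒪)^× → Pic(𝒪') → Pic(𝒪) → 1`
for `𝒪^× = 𝒪'^× = {±1}`). All statements below are about Mathlib's `ClassGroup (quadOrder K ·)`
with representatives in `K` (`ClassGroup.mk K`), in the coordinates `𝓞_K = ℤ ⊕ ℤω` of an integral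
basis `b = (1, ω)` (`Quadratic.exists_basis_zero_eq_one`):

* §1 coordinates: `𝒪_c = {X + Yω : c ∣ Y}` (`mem_quadOrder_iff_coords`), the maximal ideal
  `𝔪 = pℤ ⊕ ℤcω` of `𝒪_c` above `p` (`InM`), and "`𝒪_c ∖ 𝔪` consists of units modulo `p𝒪_c`";
* §2 `upFrac`: `𝒪_c` as a fractional `𝒪_d`-ideal (`c ∣ d`); `resFrac`: a fractional `𝒪_c`-ideal
  viewed as a fractional `𝒪_d`-ideal; the **kernel ideals** `kerFrac t = (1 + t)𝒪_d + p𝒪_c` and their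
  invertibility `kerFrac t · kerFrac (−t) = 1` for `t ∈ 𝒪_c`, `t² ∈ p𝒪_c` (`kerUnit k`: `t = kcω`);
* §3 `extFrac`/`extUnits`: extension `𝔞 ↦ 𝔞𝒪_c` and **`picRes [𝔞] = [𝔞𝒪_c]`** (`picRes_mk`), the
  lattice identity `fracIdealLattice c (𝔞𝒪_c) = fracIdealLattice d 𝔞 * 𝒪_c`, and `[𝔞_k] ∈ ker`;
* §4 **surjectivity** of `Pic(𝒪_{cp}) → Pic(𝒪_c)` (`picRes_surjective`);
* §5 **the kernel is `{[𝔞_k] : 0 ≤ k < p}`, of order `p`** (`exists_eq_kerUnit`,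
  `exists_eq_mk_kerUnit_of_picRes_eq_one`, `dvd_sub_of_mk_kerUnit_eq`, `mk_kerUnit_injOn`), using
  `𝒪_c^× = {±1}` for `c ≥ 2` (`coe_units_quadOrder_eq_one_or_eq_neg_one`);
* §6 consequences: `finite_classGroup_iff`, the **fibre sum**
  `∑_{res σ = res σ₀} F σ = ∑_{k < p} F ([𝔞_k] σ₀)` (`sum_filter_picRes_eq_sum_range`) and
  `card_filter_picRes_eq` (every fibre has `p` elements: `#Pic(𝒪_{cp}) = p · #Pic(𝒪_c)`, Cox Cor. 7.28
  with `(D/p) = 0`, `[𝒪^× : 𝒪'^×] = 1`).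

These feed the norm relations of Gross points along the `p`-tower (BD96 §2.4 (5)) and Prop. 2.7.

## References

* [BertoliniDarmon1996] M. Bertolini, H. Darmon, *Heegner points on Mumford–Tate curves*, Invent.
  Math. 126 (1996) 413–456, §2.3 (p. 432, class field theory), §2.4, Lemma 2.5.
* [Cox2013] D. A. Cox, *Primes of the form x² + ny²*, 2nd ed., Wiley 2013, §7.A (Lemma 7.2,
  p. 147; Prop. 7.4), §7.C (Cor. 7.17, p. 154; Prop. 7.20, 7.22), §7.D (Thm. 7.24 with the exact
  sequences (7.25)–(7.27), pp. 159–161; Cor. 7.28, p. 161).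
-/

noncomputable section

open scoped nonZeroDivisors Pointwise
open NumberField Module
open Literature.NumberTheory.QuadraticFields.Quadratic

namespace Literature.NumberTheory.EllipticCurves

namespace QuadOrderTower

universe u

variable {K : Type u} [Field K]

/-! ### §1 Coordinates on `𝓞_K = ℤ ⊕ ℤω` and the orders `𝒪_c = {X + Yω : c ∣ Y}` -/

section Coordinates

variable (b : Basis (Fin 2) ℤ (𝓞 K)) (hb : b 0 = 1)

/-- The second vector `ω` of an integral basis `(1, ω)` of `𝓞_K`, as an element of `K`. [folklore] -/
def omega : K := algebraMap (𝓞 K) K (b 1)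

include hb in
/-- `z = X + Y b₁` with `(X, Y) = b.repr z`. [folklore] -/
private theorem eq_repr_add_repr_mul (z : 𝓞 K) :
    z = (b.repr z 0 : 𝓞 K) + (b.repr z 1 : 𝓞 K) * b 1 := by
  conv_lhs => rw [← b.sum_repr z]
  rw [Fin.sum_univ_two, hb, zsmul_eq_mul, mul_one, zsmul_eq_mul]

include hb in
/-- In `K`: `z = X + Yω`. [folklore] -/
private theorem algebraMap_eq_repr (z : 𝓞 K) :
    algebraMap (𝓞 K) K z = (b.repr z 0 : K) + (b.repr z 1 : K) * omega b := by
  conv_lhs => rw [eq_repr_add_repr_mul b hb z]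
  simp [omega]

include hb in
/-- Coordinates of `X + Y b₁`. [folklore] -/
private theorem repr_intCast_add_intCast_mul (X Y : ℤ) :
    b.repr ((X : 𝓞 K) + (Y : 𝓞 K) * b 1) 0 = X ∧ b.repr ((X : 𝓞 K) + (Y : 𝓞 K) * b 1) 1 = Y := by
  have h : (X : 𝓞 K) + (Y : 𝓞 K) * b 1 = X • b 0 + Y • b 1 := by
    rw [hb, zsmul_eq_mul, mul_one, zsmul_eq_mul]
  rw [h, map_add, map_zsmul, map_zsmul, b.repr_self, b.repr_self]
  simp

include hb in
/-- **Uniqueness of coordinates**: `X + Yω = X' + Y'ω` in `K` forces `X = X'` and `Y = Y'`. [cite: Cox2013, §7.A Lemma 7.2] -/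
theorem coords_unique [NumberField K] {X Y X' Y' : ℤ}
    (h : (X : K) + (Y : K) * omega b = (X' : K) + (Y' : K) * omega b) : X = X' ∧ Y = Y' := by
  have h' : (X : 𝓞 K) + (Y : 𝓞 K) * b 1 = (X' : 𝓞 K) + (Y' : 𝓞 K) * b 1 := by
    apply IsFractionRing.injective (𝓞 K) K
    simpa [omega] using h
  have h0 := congrArg (fun z => b.repr z 0) h'
  have h1 := congrArg (fun z => b.repr z 1) h'
  rw [(repr_intCast_add_intCast_mul b hb X Y).1, (repr_intCast_add_intCast_mul b hb X' Y').1] at h0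
  rw [(repr_intCast_add_intCast_mul b hb X Y).2, (repr_intCast_add_intCast_mul b hb X' Y').2] at h1
  exact ⟨h0, h1⟩

/-- The structure constant `m` in `ω² = m + tω`. [folklore] -/
def mConst : ℤ := b.repr (b 1 * b 1) 0

/-- The structure constant `t` in `ω² = m + tω`. [folklore] -/
def tConst : ℤ := b.repr (b 1 * b 1) 1

include hb in
/-- `ω · ω = m + tω` in `K`. [folklore] -/
private theorem omega_mul_omega :
    omega b * omega b = (mConst b : K) + (tConst b : K) * omega b := by
  have h' := congrArg (algebraMap (𝓞 K) K) (basis_one_mul_self_eq b hb)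
  simpa [omega, mConst, tConst] using h'

include hb in
/-- Product formula `(X + Yω)(X' + Y'ω) = (XX' + YY'm) + (XY' + X'Y + YY't)ω`. [folklore] -/
private theorem coords_mul (X Y X' Y' : ℤ) :
    ((X : K) + (Y : K) * omega b) * ((X' : K) + (Y' : K) * omega b) =
      ((X * X' + Y * Y' * mConst b : ℤ) : K) +
        ((X * Y' + X' * Y + Y * Y' * tConst b : ℤ) : K) * omega b := by
  have hω := omega_mul_omega b hb
  push_cast
  linear_combination ((Y : K) * (Y' : K)) * hω

include hb in
/-- **Membership in `𝒪_c`**: `x ∈ ℤ + c𝓞_K` iff `x = X + Yω` with `c ∣ Y`. [cite: Cox2013, §7.A Lemma 7.2] -/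
theorem mem_quadOrder_iff_coords {c : ℕ} {x : K} :
    x ∈ quadOrder K c ↔ ∃ X Y : ℤ, (c : ℤ) ∣ Y ∧ x = (X : K) + (Y : K) * omega b := by
  constructor
  · rintro ⟨a, y, rfl⟩
    refine ⟨a + c * b.repr y 0, c * b.repr y 1, dvd_mul_right _ _, ?_⟩
    rw [algebraMap_eq_repr b hb y]
    push_cast
    ring
  · rintro ⟨X, Y, ⟨k, rfl⟩, rfl⟩
    refine ⟨X, (k : 𝓞 K) * b 1, ?_⟩
    simp only [omega, map_mul, map_intCast, Int.cast_mul, Int.cast_natCast]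
    ring

include hb in
/-- `X + Yω ∈ 𝒪_c` for `c ∣ Y`. [cite: Cox2013, §7.A Lemma 7.2] -/
theorem coords_mem_quadOrder {c : ℕ} {X Y : ℤ} (hY : (c : ℤ) ∣ Y) :
    (X : K) + (Y : K) * omega b ∈ quadOrder K c :=
  (mem_quadOrder_iff_coords b hb).mpr ⟨X, Y, hY, rfl⟩

include hb in
/-- `Yω ∈ 𝒪_c` for `c ∣ Y`. [cite: Cox2013, §7.A Lemma 7.2] -/
theorem intCast_mul_omega_mem {c : ℕ} {Y : ℤ} (hY : (c : ℤ) ∣ Y) :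
    (Y : K) * omega b ∈ quadOrder K c := by
  simpa using coords_mem_quadOrder b hb (X := 0) hY

include hb in
/-- `cω ∉ 𝒪_{d}` when `d ∤ c` (e.g. `d = cp`, `p > 1`, `c ≠ 0`). [cite: Cox2013, §7.A Lemma 7.2] -/
theorem natCast_mul_omega_not_mem [NumberField K] {c d : ℕ} (h : ¬ (d : ℤ) ∣ c) :
    (c : K) * omega b ∉ quadOrder K d := by
  intro hmem
  obtain ⟨X, Y, hY, hXY⟩ := (mem_quadOrder_iff_coords b hb).mp hmem
  have h1 : ((0 : ℤ) : K) + ((c : ℤ) : K) * omega b = (X : K) + (Y : K) * omega b := by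
    push_cast; simpa using hXY
  obtain ⟨-, rfl⟩ := coords_unique b hb h1
  exact h hY

/-! #### The maximal ideal `𝔪 = pℤ ⊕ ℤcω` of `𝒪_c` above `p` (`p ∣ c`) -/

/-- **Membership in `𝔪 = pℤ ⊕ ℤcω ⊆ 𝒪_c`** (`p ∣ c`): `x = X + Yω` with `p ∣ X`, `c ∣ Y`. This is the
unique maximal ideal of `𝒪_c` above `p` (`𝒪_c/𝔪 = 𝔽_p`, `p𝒪_c ⊆ 𝔪`); we use: it is an ideal
containing `p𝒪_c`, `1 ∉ 𝔪`, and elements of `𝒪_c ∖ 𝔪` are invertible modulo `p𝒪_c`. [cite: Cox2013, §7.D Thm. 7.24, (7.27)] -/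
def InM (c p : ℕ) (x : K) : Prop :=
  ∃ X Y : ℤ, (p : ℤ) ∣ X ∧ (c : ℤ) ∣ Y ∧ x = (X : K) + (Y : K) * omega b

variable {b}

include hb in
/-- `𝔪 ⊆ 𝒪_c`. [folklore] -/
private theorem InM.mem {c p : ℕ} {x : K} (h : InM b c p x) : x ∈ quadOrder K c := by
  obtain ⟨X, Y, -, hY, rfl⟩ := h
  exact coords_mem_quadOrder b hb hY

/-- `0 ∈ 𝔪`. [folklore] -/
private theorem InM.zero {c p : ℕ} : InM b c p (0 : K) := ⟨0, 0, dvd_zero _, dvd_zero _, by simp⟩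

/-- `𝔪` is closed under addition. [folklore] -/
private theorem InM.add {c p : ℕ} {x y : K} (hx : InM b c p x) (hy : InM b c p y) : InM b c p (x + y) := by
  obtain ⟨X, Y, hX, hY, rfl⟩ := hx
  obtain ⟨X', Y', hX', hY', rfl⟩ := hy
  exact ⟨X + X', Y + Y', dvd_add hX hX', dvd_add hY hY', by push_cast; ring⟩

/-- `𝔪` is closed under negation. [folklore] -/
private theorem InM.neg {c p : ℕ} {x : K} (hx : InM b c p x) : InM b c p (-x) := by
  obtain ⟨X, Y, hX, hY, rfl⟩ := hx
  exact ⟨-X, -Y, (dvd_neg).mpr hX, (dvd_neg).mpr hY, by push_cast; ring⟩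

/-- `𝔪` is closed under subtraction. [folklore] -/
private theorem InM.sub {c p : ℕ} {x y : K} (hx : InM b c p x) (hy : InM b c p y) : InM b c p (x - y) := by
  rw [sub_eq_add_neg]; exact hx.add hy.neg

include hb in
/-- `𝔪` is an ideal of `𝒪_c`: `𝔪 · 𝒪_c ⊆ 𝔪` (`p ∣ c`). [folklore] -/
private theorem InM.mul_mem {c p : ℕ} (hpc : p ∣ c) {x y : K} (hx : InM b c p x) (hy : y ∈ quadOrder K c) :
    InM b c p (x * y) := by
  obtain ⟨X, Y, hX, hY, rfl⟩ := hx
  obtain ⟨X', Y', hY', rfl⟩ := (mem_quadOrder_iff_coords b hb).mp hy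
  refine ⟨X * X' + Y * Y' * mConst b, X * Y' + X' * Y + Y * Y' * tConst b, ?_, ?_,
    coords_mul b hb X Y X' Y'⟩
  · have hpY : (p : ℤ) ∣ Y := (Int.natCast_dvd_natCast.mpr hpc).trans hY
    exact dvd_add (dvd_mul_of_dvd_left hX _) (dvd_mul_of_dvd_left (dvd_mul_of_dvd_left hpY _) _)
  · exact dvd_add (dvd_add (dvd_mul_of_dvd_right hY' _) (dvd_mul_of_dvd_right hY _))
      (dvd_mul_of_dvd_left (dvd_mul_of_dvd_left hY _) _)

include hb in
/-- `𝒪_c · 𝔪 ⊆ 𝔪`. [folklore] -/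
private theorem InM.mem_mul {c p : ℕ} (hpc : p ∣ c) {x y : K} (hx : x ∈ quadOrder K c) (hy : InM b c p y) :
    InM b c p (x * y) := by
  rw [mul_comm]; exact hy.mul_mem hb hpc hx

include hb in
/-- `p 𝒪_c ⊆ 𝔪`. [folklore] -/
private theorem InM.natCast_mul {c p : ℕ} {y : K} (hy : y ∈ quadOrder K c) : InM b c p ((p : K) * y) := by
  obtain ⟨X', Y', hY', rfl⟩ := (mem_quadOrder_iff_coords b hb).mp hy
  exact ⟨p * X', p * Y', dvd_mul_right _ _, dvd_mul_of_dvd_right hY' _, by push_cast; ring⟩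

include hb in
/-- Dichotomy in `𝒪_c`: an element lies in `𝔪` or is `X + Yω` with `p ∤ X`. [folklore] -/
private theorem inM_or_exists_coords {c p : ℕ} {x : K} (hx : x ∈ quadOrder K c) :
    InM b c p x ∨ ∃ X Y : ℤ, ¬ (p : ℤ) ∣ X ∧ (c : ℤ) ∣ Y ∧ x = (X : K) + (Y : K) * omega b := by
  obtain ⟨X, Y, hY, rfl⟩ := (mem_quadOrder_iff_coords b hb).mp hx
  by_cases hX : (p : ℤ) ∣ X
  · exact Or.inl ⟨X, Y, hX, hY, rfl⟩
  · exact Or.inr ⟨X, Y, hX, hY, rfl⟩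

include hb in
/-- `1 ∉ 𝔪` (for `p` prime, indeed `p ≠ 1`). [folklore] -/
private theorem not_inM_one [NumberField K] {c p : ℕ} (hp : p.Prime) : ¬ InM b c p (1 : K) := by
  rintro ⟨X, Y, hX, -, h⟩
  have h1 : ((1 : ℤ) : K) + ((0 : ℤ) : K) * omega b = (X : K) + (Y : K) * omega b := by
    push_cast; simpa using h
  obtain ⟨rfl, -⟩ := coords_unique b hb h1
  exact hp.one_lt.ne' (by exact_mod_cast Int.eq_one_of_dvd_one (Int.natCast_nonneg p) hX)

include hb in
/-- `(Yω)(Y'ω) = p s` with `s ∈ 𝒪_c`, for `c ∣ Y`, `c ∣ Y'`, `p ∣ c` (`YY'ω² = YY'm + YY'tω` and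
`pc ∣ YY'`): the "`cω`-part" of `𝒪_c` squares into `p𝒪_c`. [folklore] -/
private theorem exists_mul_omega_mul_mul_omega_eq {c p : ℕ} (hpc : p ∣ c) {Y Y' : ℤ} (hY : (c : ℤ) ∣ Y)
    (hY' : (c : ℤ) ∣ Y') :
    ∃ s ∈ quadOrder K c, ((Y : K) * omega b) * ((Y' : K) * omega b) = (p : K) * s := by
  obtain ⟨k, rfl⟩ := hpc
  obtain ⟨y, rfl⟩ := hY
  obtain ⟨y', rfl⟩ := hY'
  refine ⟨((k * (p * k) * y * y' * mConst b : ℤ) : K) +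
      ((k * (p * k) * y * y' * tConst b : ℤ) : K) * omega b,
    coords_mem_quadOrder b hb ⟨k * y * y' * tConst b, by push_cast; ring⟩, ?_⟩
  have hω := omega_mul_omega b hb
  push_cast
  linear_combination ((p : K) * k * y * ((p : K) * k * y')) * hω

include hb in
/-- **Elements of `𝒪_c ∖ 𝔪` are units modulo `p𝒪_c`**: if `u = X + Yω ∈ 𝒪_c` with `p ∤ X` then
`u w = 1 + p z` for some `w, z ∈ 𝒪_c` (`𝒪_c / p𝒪_c ≅ 𝔽_p[ε]/(ε²)` is local). [cite: Cox2013, §7.D Thm. 7.24, (7.27)] -/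
theorem exists_mul_eq_one_add_of_not_dvd {c p : ℕ} (hp : p.Prime) (hpc : p ∣ c) {X Y : ℤ}
    (hX : ¬ (p : ℤ) ∣ X) (hY : (c : ℤ) ∣ Y) :
    ∃ w ∈ quadOrder K c, ∃ z ∈ quadOrder K c,
      ((X : K) + (Y : K) * omega b) * w = 1 + (p : K) * z := by
  have hpZ : Prime (p : ℤ) := Nat.prime_iff_prime_int.mp hp
  obtain ⟨q, X', hqX⟩ := (Prime.coprime_iff_not_dvd hpZ).mpr hX
  -- `hqX : q * p + X' * X = 1`
  obtain ⟨s, hs, hss⟩ := exists_mul_omega_mul_mul_omega_eq (K := K) hb hpc hY hY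
  refine ⟨(X' : K) - ((X' ^ 2 * Y : ℤ) : K) * omega b, ?_,
    -(q : K) + ((X' * q : ℤ) : K) * ((Y : K) * omega b) - (X' : K) ^ 2 * s, ?_, ?_⟩
  · have hmem : ((X' : ℤ) : K) + ((-(X' ^ 2 * Y) : ℤ) : K) * omega b ∈ quadOrder K c :=
      coords_mem_quadOrder b hb ((dvd_neg).mpr (dvd_mul_of_dvd_right hY _))
    convert hmem using 1
    push_cast; ring
  · refine Subalgebra.sub_mem _ (Subalgebra.add_mem _ (Subalgebra.neg_mem _
      (Subalgebra.intCast_mem _ q)) (Subalgebra.mul_mem _ (Subalgebra.intCast_mem _ _)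
      (intCast_mul_omega_mem b hb hY))) ?_
    exact Subalgebra.mul_mem _ (Subalgebra.pow_mem _ (Subalgebra.intCast_mem _ _) 2) hs
  · have hq : (X : K) * (X' : K) = 1 - (q : K) * (p : K) := by
      have h1 := congrArg (fun z : ℤ => (z : K)) hqX
      push_cast at h1
      linear_combination h1
    push_cast
    linear_combination (-(X' : K) ^ 2) * hss + (1 - (X' : K) * ((Y : K) * omega b)) * hq

end Coordinates

/-! ### §2 `𝒪_c` and fractional `𝒪_c`-ideals as fractional `𝒪_d`-ideals (`c ∣ d`); kernel ideals -/

section Frac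

variable {c d : ℕ}

/-- `k x ∈ 𝒪_d` for `x ∈ 𝒪_c` and `d = c k`. [cite: Cox2013, §7.A Lemma 7.2] -/
theorem natCast_mul_mem_quadOrder_of_eq_mul {k : ℕ} (hd : d = c * k) {x : K}
    (hx : x ∈ quadOrder K c) : (k : K) * x ∈ quadOrder K d := by
  obtain ⟨a, y, rfl⟩ := hx
  subst hd
  refine ⟨k * a, y, ?_⟩
  push_cast; ring

/-- Helper: membership in a fractional ideal is membership in its submodule (for rewriting). [folklore] -/
private theorem mem_fi {R : Type*} [CommRing R] {S : Submonoid R} {P : Type*} [CommRing P] [Algebra R P]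
    {I : FractionalIdeal S P} {x : P} : x ∈ I ↔ x ∈ (I : Submodule R P) := Iff.rfl

/-- A fractional ideal is closed under subtraction. [folklore] -/
private theorem sub_mem_fi {R : Type*} [CommRing R] {S : Submonoid R} {P : Type*} [CommRing P] [Algebra R P]
    {I : FractionalIdeal S P} {x y : P} (hx : x ∈ I) (hy : y ∈ I) : x - y ∈ I :=
  Submodule.sub_mem _ hx hy

/-- A fractional ideal contains `0`. [folklore] -/
private theorem zero_mem_fi {R : Type*} [CommRing R] {S : Submonoid R} {P : Type*} [CommRing P] [Algebra R P]
    {I : FractionalIdeal S P} : (0 : P) ∈ I :=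
  Submodule.zero_mem _

/-- A fractional ideal is closed under addition. [folklore] -/
private theorem add_mem_fi {R : Type*} [CommRing R] {S : Submonoid R} {P : Type*} [CommRing P] [Algebra R P]
    {I : FractionalIdeal S P} {x y : P} (hx : x ∈ I) (hy : y ∈ I) : x + y ∈ I :=
  Submodule.add_mem _ hx hy

/-- The `𝒪_d`-submodule of `K` underlying an `𝒪_c`-submodule (`c ∣ d`, restriction of scalars
along `𝒪_d ⊆ 𝒪_c`, written out to avoid an `Algebra 𝒪_d 𝒪_c` instance). [folklore] -/
def resSub (h : c ∣ d) (M : Submodule (quadOrder K c) K) : Submodule (quadOrder K d) K where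
  carrier := M
  add_mem' := fun hx hy => M.add_mem hx hy
  zero_mem' := M.zero_mem
  smul_mem' := fun a x hx =>
    show (a : K) * x ∈ M from M.smul_mem (⟨a, quadOrder_le_of_dvd h a.2⟩ : quadOrder K c) hx

/-- Membership in `resSub` (definitional). [folklore] -/
@[simp] private theorem mem_resSub_iff (h : c ∣ d) {M : Submodule (quadOrder K c) K} {x : K} :
    x ∈ resSub h M ↔ x ∈ M := Iff.rfl

variable [NumberField K] [NeZero d]

/-- **A fractional `𝒪_c`-ideal as a fractional `𝒪_d`-ideal** (`c ∣ d`): same subset of `K`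
(denominators: if `a 𝔟 ⊆ 𝒪_c` then `(d/c) a 𝔟 ⊆ 𝒪_d`). [folklore] -/
def resFrac (h : c ∣ d) (I : FractionalIdeal (quadOrder K c)⁰ K) :
    FractionalIdeal (quadOrder K d)⁰ K :=
  ⟨resSub h (I : Submodule (quadOrder K c) K), by
    obtain ⟨k, hk⟩ := h
    obtain ⟨a, ha, hI⟩ := I.isFractional
    have hk0 : (k : K) ≠ 0 := by
      intro h0
      have : (d : K) = 0 := by rw [hk]; push_cast; rw [h0, mul_zero]
      exact NeZero.ne d (by exact_mod_cast this)
    have ha0 : (a : K) ≠ 0 := by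
      intro h0
      have : a = 0 := Subtype.ext h0
      exact nonZeroDivisors.ne_zero ha this
    refine ⟨⟨(k : K) * a, natCast_mul_mem_quadOrder_of_eq_mul hk a.2⟩,
      mem_nonZeroDivisors_of_ne_zero (fun h0 => ?_), fun x hx => ?_⟩
    · have := congrArg ((↑) : quadOrder K d → K) h0
      simp only [ZeroMemClass.coe_zero, mul_eq_zero] at this
      exact this.elim hk0 ha0
    · obtain ⟨y, hy⟩ := hI x hx
      refine ⟨⟨(k : K) * (y : K), natCast_mul_mem_quadOrder_of_eq_mul hk y.2⟩, ?_⟩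
      have hy' : (y : K) = (a : K) * x := by
        change algebraMap (quadOrder K c) K y = _
        rw [hy]; rfl
      change (k : K) * (y : K) = ((k : K) * a) * x
      rw [hy', mul_assoc]⟩

/-- Membership in `resFrac` (definitional). [folklore] -/
@[simp] private theorem mem_resFrac_iff (h : c ∣ d) {I : FractionalIdeal (quadOrder K c)⁰ K} {x : K} :
    x ∈ resFrac h I ↔ x ∈ I := Iff.rfl

/-- **`𝒪_c` as a fractional `𝒪_d`-ideal**, `c ∣ d`. [folklore] -/
def upFrac (h : c ∣ d) : FractionalIdeal (quadOrder K d)⁰ K :=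
  resFrac h 1

/-- Membership in `upFrac` is membership in `𝒪_c`. [cite: Cox2013, §7.A Lemma 7.2] -/
@[simp] theorem mem_upFrac_iff (h : c ∣ d) {x : K} : x ∈ upFrac (K := K) h ↔ x ∈ quadOrder K c := by
  rw [upFrac, mem_resFrac_iff, FractionalIdeal.mem_one_iff]
  constructor
  · rintro ⟨y, rfl⟩; exact y.2
  · intro hx; exact ⟨⟨x, hx⟩, rfl⟩

/-- `resFrac` is multiplicative. [folklore] -/
private theorem resFrac_mul (h : c ∣ d) (I J : FractionalIdeal (quadOrder K c)⁰ K) :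
    resFrac h (I * J) = resFrac h I * resFrac h J := by
  apply le_antisymm
  · intro x hx
    rw [mem_fi, ] at hx ⊢
    change x ∈ ((I * J : FractionalIdeal _ K) : Submodule (quadOrder K c) K) at hx
    rw [FractionalIdeal.coe_mul] at hx ⊢
    refine Submodule.mul_induction_on hx (fun m hm n hn => ?_) (fun x y hx hy => add_mem hx hy)
    exact Submodule.mul_mem_mul (show m ∈ resFrac h I from hm) (show n ∈ resFrac h J from hn)
  · rw [FractionalIdeal.mul_le]
    intro m hm n hn
    exact FractionalIdeal.mul_mem_mul (show m ∈ I from hm) (show n ∈ J from hn)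

/-- `resFrac` is monotone and reflects `≤`. [folklore] -/
private theorem resFrac_le_iff (h : c ∣ d) {I J : FractionalIdeal (quadOrder K c)⁰ K} :
    resFrac h I ≤ resFrac h J ↔ I ≤ J := by
  constructor
  · intro hle x hx; exact hle (show x ∈ resFrac h I from hx)
  · intro hle x hx; exact hle (show x ∈ I from hx)

/-- `resFrac` is injective. [folklore] -/
private theorem resFrac_injective (h : c ∣ d) : Function.Injective (resFrac (K := K) h) := by
  intro I J hIJ
  exact le_antisymm ((resFrac_le_iff h).mp hIJ.le) ((resFrac_le_iff h).mp hIJ.ge)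

/-- `𝒪_c · 𝒪_c = 𝒪_c` as fractional `𝒪_d`-ideals. [cite: Cox2013, §7.A Lemma 7.2] -/
theorem upFrac_mul_upFrac (h : c ∣ d) : upFrac (K := K) h * upFrac h = upFrac h := by
  rw [upFrac, ← resFrac_mul, mul_one]

/-- `𝒪_d ⊆ 𝒪_c`: `1 ≤ upFrac`. [cite: Cox2013, §7.A Lemma 7.2] -/
theorem one_le_upFrac (h : c ∣ d) : (1 : FractionalIdeal (quadOrder K d)⁰ K) ≤ upFrac h := by
  rw [FractionalIdeal.one_le, mem_upFrac_iff]; exact Subalgebra.one_mem _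

/-- `p 𝒪_c ⊆ 𝒪_{cp}`: `(p) · upFrac ≤ 1` for `d = c p`. [cite: Cox2013, §7.A Lemma 7.2] -/
theorem spanSingleton_mul_upFrac_le_one {p : ℕ} (hd : d = c * p) :
    FractionalIdeal.spanSingleton (quadOrder K d)⁰ (p : K) * upFrac (Dvd.intro p hd.symm) ≤ 1 := by
  rw [FractionalIdeal.mul_le]
  intro x hx y hy
  obtain ⟨z, rfl⟩ := (FractionalIdeal.mem_spanSingleton _).mp hx
  rw [mem_upFrac_iff] at hy
  rw [FractionalIdeal.mem_one_iff]
  refine ⟨⟨(z : K) * ((p : K) * y), Subalgebra.mul_mem _ z.2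
    (natCast_mul_mem_quadOrder_of_eq_mul hd hy)⟩, ?_⟩
  rw [Algebra.smul_def, mul_assoc]; rfl

/-! #### The kernel ideals `𝔞_t = (1 + t)𝒪_d + p𝒪_c` -/

/-- **The kernel ideal `𝔞_t := (1 + t)𝒪_d + p 𝒪_c`** as a fractional `𝒪_d`-ideal (`c ∣ d`); for
`d = cp`, `t ∈ 𝒪_c` with `t² ∈ p𝒪_c` (e.g. `t = k c ω`) it is invertible with inverse `𝔞_{−t}`
(`kerFrac_mul_kerFrac_neg`) and generates the kernel of `Pic(𝒪_{cp}) → Pic(𝒪_c)` (§5); as a lattice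
`𝔞_{kcω} = ℤ(1 + kcω) ⊕ p𝒪_c`-translates, Cox's `[α] ∈ (𝒪/p𝒪)^×` with `α = 1 + kcω`. [cite: Cox2013, §7.D Thm. 7.24 (7.25)–(7.27), Cor. 7.28] -/
def kerFrac (h : c ∣ d) (p : ℕ) (t : K) : FractionalIdeal (quadOrder K d)⁰ K :=
  FractionalIdeal.spanSingleton (quadOrder K d)⁰ (1 + t) +
    FractionalIdeal.spanSingleton (quadOrder K d)⁰ (p : K) * upFrac h

/-- Membership in `𝔞_t`: `x = u (1 + t) + p r` with `u ∈ 𝒪_d`, `r ∈ 𝒪_c`. [cite: Cox2013, §7.D Thm. 7.24, (7.27)] -/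
theorem mem_kerFrac_iff (h : c ∣ d) {p : ℕ} {t x : K} :
    x ∈ kerFrac h p t ↔
      ∃ u ∈ quadOrder K d, ∃ r ∈ quadOrder K c, x = u * (1 + t) + (p : K) * r := by
  rw [kerFrac, mem_fi, FractionalIdeal.coe_add, Submodule.add_eq_sup, Submodule.mem_sup]
  constructor
  · rintro ⟨y, hy, z, hz, rfl⟩
    obtain ⟨u, rfl⟩ := (FractionalIdeal.mem_spanSingleton _).mp hy
    obtain ⟨r, hr, rfl⟩ := FractionalIdeal.mem_singleton_mul.mp hz
    rw [mem_upFrac_iff] at hr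
    exact ⟨u, u.2, r, hr, by rw [Algebra.smul_def]; rfl⟩
  · rintro ⟨u, hu, r, hr, rfl⟩
    refine ⟨(⟨u, hu⟩ : quadOrder K d) • (1 + t), (FractionalIdeal.mem_spanSingleton _).mpr ⟨_, rfl⟩,
      (p : K) * r, FractionalIdeal.mem_singleton_mul.mpr ⟨r, (mem_upFrac_iff h).mpr hr, rfl⟩, ?_⟩
    rw [Algebra.smul_def]; rfl

/-- `u (1 + t) ∈ 𝔞_t` for `u ∈ 𝒪_d`. [cite: Cox2013, §7.D Thm. 7.24, (7.27)] -/
theorem mul_one_add_mem_kerFrac (h : c ∣ d) {p : ℕ} {t u : K} (hu : u ∈ quadOrder K d) :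
    u * (1 + t) ∈ kerFrac h p t :=
  (mem_kerFrac_iff h).mpr ⟨u, hu, 0, Subalgebra.zero_mem _, by simp⟩

/-- `1 + t ∈ 𝔞_t`. [cite: Cox2013, §7.D Thm. 7.24, (7.27)] -/
theorem one_add_mem_kerFrac (h : c ∣ d) {p : ℕ} {t : K} : 1 + t ∈ kerFrac h p t := by
  simpa using mul_one_add_mem_kerFrac (K := K) h (p := p) (t := t) (Subalgebra.one_mem _)

/-- `p r ∈ 𝔞_t` for `r ∈ 𝒪_c`. [cite: Cox2013, §7.D Thm. 7.24, (7.27)] -/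
theorem natCast_mul_mem_kerFrac (h : c ∣ d) {p : ℕ} {t r : K} (hr : r ∈ quadOrder K c) :
    (p : K) * r ∈ kerFrac h p t :=
  (mem_kerFrac_iff h).mpr ⟨0, Subalgebra.zero_mem _, r, hr, by simp⟩

/-- `p 𝒪_c ⊆ 𝔞_t`, as fractional ideals. [cite: Cox2013, §7.D Thm. 7.24, (7.27)] -/
theorem spanSingleton_mul_upFrac_le_kerFrac (h : c ∣ d) (p : ℕ) (t : K) :
    FractionalIdeal.spanSingleton (quadOrder K d)⁰ (p : K) * upFrac h ≤ kerFrac h p t :=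
  le_add_self

/-- `𝔞_t ⊆ 𝒪_c` for `t ∈ 𝒪_c`. [cite: Cox2013, §7.D Thm. 7.24, (7.27)] -/
theorem kerFrac_le_upFrac (h : c ∣ d) {p : ℕ} {t : K} (ht : t ∈ quadOrder K c) :
    kerFrac h p t ≤ upFrac h := by
  intro x hx
  obtain ⟨u, hu, r, hr, rfl⟩ := (mem_kerFrac_iff h).mp hx
  rw [mem_fi, FractionalIdeal.mem_coe, mem_upFrac_iff]
  exact Subalgebra.add_mem _ (Subalgebra.mul_mem _ (quadOrder_le_of_dvd h hu)
    (Subalgebra.add_mem _ (Subalgebra.one_mem _) ht))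
    (Subalgebra.mul_mem _ (Subalgebra.natCast_mem _ p) hr)

/-- **`𝔞_t 𝒪_c = 𝒪_c`** for `t ∈ 𝒪_c` with `t² = p s`, `s ∈ 𝒪_c`: `⊆` as `𝔞_t ⊆ 𝒪_c`; `⊇` since
`x = (1+t)x − (1+t)(tx) + (ps)x`. (So `𝔞_t` becomes trivial in `Pic(𝒪_c)`.) [cite: Cox2013, §7.D Thm. 7.24 (7.25)–(7.27), Cor. 7.28] -/
theorem kerFrac_mul_upFrac (h : c ∣ d) {p : ℕ} {t s : K} (ht : t ∈ quadOrder K c)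
    (hs : s ∈ quadOrder K c) (hts : t * t = (p : K) * s) :
    kerFrac h p t * upFrac h = upFrac h := by
  apply le_antisymm
  · calc kerFrac h p t * upFrac h ≤ upFrac h * upFrac h :=
          mul_le_mul_left (kerFrac_le_upFrac h ht) _
      _ = upFrac h := upFrac_mul_upFrac h
  · intro x hx
    rw [mem_fi, FractionalIdeal.mem_coe, mem_upFrac_iff] at hx
    have hx' : x ∈ upFrac (K := K) h := (mem_upFrac_iff h).mpr hx
    have e : x = (1 + t) * x - (1 + t) * (t * x) + ((p : K) * s) * x := by linear_combination x * hts
    rw [mem_fi, FractionalIdeal.mem_coe, e]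
    refine add_mem_fi (sub_mem_fi (FractionalIdeal.mul_mem_mul (one_add_mem_kerFrac h) hx')
      (FractionalIdeal.mul_mem_mul (one_add_mem_kerFrac h) ?_))
      (FractionalIdeal.mul_mem_mul (natCast_mul_mem_kerFrac h hs) hx')
    exact (mem_upFrac_iff h).mpr (Subalgebra.mul_mem _ ht hx)

/-- **`𝔞_t · 𝔞_{−t} = 𝒪_d`** (`d = cp`, `t ∈ 𝒪_c`, `t² = ps` with `s ∈ 𝒪_c`): the kernel ideals are
invertible. `⊆`: `(u(1+t) + pr)(v(1−t) + pr') = uv(1 − ps) + p(⋯) ∈ 𝒪_d`; `⊇`: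
`1 = (1+t)(1−t) + (1+t)(ps) − (pts)(1−t) − (ps)(ps)`. [cite: Cox2013, §7.D Thm. 7.24 (7.25)–(7.27), Cor. 7.28] -/
theorem kerFrac_mul_kerFrac_neg {p : ℕ} (hd : d = c * p) {t s : K} (ht : t ∈ quadOrder K c)
    (hs : s ∈ quadOrder K c) (hts : t * t = (p : K) * s) :
    kerFrac (Dvd.intro p hd.symm) p t * kerFrac (Dvd.intro p hd.symm) p (-t) = 1 := by
  have h : c ∣ d := Dvd.intro p hd.symm
  apply le_antisymm
  · rw [FractionalIdeal.mul_le]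
    intro x hx y hy
    obtain ⟨u, hu, r, hr, rfl⟩ := (mem_kerFrac_iff h).mp hx
    obtain ⟨v, hv, r', hr', rfl⟩ := (mem_kerFrac_iff h).mp hy
    have e : (u * (1 + t) + (p : K) * r) * (v * (1 + -t) + (p : K) * r') =
        u * v - u * v * ((p : K) * s) +
          (p : K) * (u * (1 + t) * r' + v * (1 - t) * r + (p : K) * (r * r')) := by
      linear_combination (-(u * v)) * hts
    rw [e, FractionalIdeal.mem_one_iff]
    have hu' := quadOrder_le_of_dvd h hu
    have hv' := quadOrder_le_of_dvd h hv
    refine ⟨⟨_, Subalgebra.add_mem _ (Subalgebra.sub_mem _ (Subalgebra.mul_mem _ hu hv) ?_)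
      (natCast_mul_mem_quadOrder_of_eq_mul hd ?_)⟩, rfl⟩
    · rw [mul_assoc]
      exact Subalgebra.mul_mem _ hu (hd ▸ natCast_mul_mem_quadOrder_of_eq_mul (K := K) rfl
        (Subalgebra.mul_mem _ hv' hs) |> fun h' => by rwa [← mul_assoc, mul_comm (p : K) v, mul_assoc] at h')
    · refine Subalgebra.add_mem _ (Subalgebra.add_mem _ ?_ ?_) ?_
      · exact Subalgebra.mul_mem _ (Subalgebra.mul_mem _ hu' (Subalgebra.add_mem _
          (Subalgebra.one_mem _) ht)) hr'
      · exact Subalgebra.mul_mem _ (Subalgebra.mul_mem _ hv' (Subalgebra.sub_mem _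
          (Subalgebra.one_mem _) ht)) hr
      · exact Subalgebra.mul_mem _ (Subalgebra.natCast_mem _ p) (Subalgebra.mul_mem _ hr hr')
  · rw [FractionalIdeal.one_le]
    have e : (1 : K) = (1 + t) * (1 + -t) + (1 + t) * ((p : K) * s) -
        ((p : K) * (t * s)) * (1 + -t) - ((p : K) * s) * ((p : K) * s) := by
      linear_combination (1 - (p : K) * s) * hts
    rw [e]
    have hps : (p : K) * s ∈ kerFrac h p (-t) := natCast_mul_mem_kerFrac h hs
    refine sub_mem_fi (sub_mem_fi (add_mem_fi
      (FractionalIdeal.mul_mem_mul (one_add_mem_kerFrac h) (one_add_mem_kerFrac h))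
      (FractionalIdeal.mul_mem_mul (one_add_mem_kerFrac h) hps))
      (FractionalIdeal.mul_mem_mul (natCast_mul_mem_kerFrac h (Subalgebra.mul_mem _ ht hs))
        (one_add_mem_kerFrac h)))
      (FractionalIdeal.mul_mem_mul (natCast_mul_mem_kerFrac h hs) hps)

end Frac

/-! ### §3 The kernel units, extension `𝔞 ↦ 𝔞𝒪_c`, and `picRes` on representatives -/

section Ext

variable {c d : ℕ} [NumberField K] [NeZero d]

/-- **The kernel unit `𝔞_k := (1 + kcω)𝒪_{cp} + p𝒪_c`** (`k : ℤ`), an invertible fractional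
`𝒪_{cp}`-ideal with inverse `𝔞_{−k}` (`p ∣ c`, `d = cp`). Its class lies in the kernel of
`Pic(𝒪_{cp}) → Pic(𝒪_c)` (`picRes_mk_kerUnit`), and the classes of `𝔞_0, …, 𝔞_{p−1}` exhaust that
kernel without repetition (§5): Cox's isomorphism `(𝒪/p𝒪)^× / (ℤ/p)^× ≅ ker`, `[1 + kcω] ↦ [𝔞_k]`. [cite: Cox2013, §7.D Thm. 7.24 (7.25)–(7.27), Cor. 7.28] -/
def kerUnit (b : Basis (Fin 2) ℤ (𝓞 K)) (hb : b 0 = 1) {p : ℕ} (hpc : p ∣ c) (hd : d = c * p)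
    (k : ℤ) : (FractionalIdeal (quadOrder K d)⁰ K)ˣ where
  val := kerFrac (Dvd.intro p hd.symm) p (((k * c : ℤ) : K) * omega b)
  inv := kerFrac (Dvd.intro p hd.symm) p (-(((k * c : ℤ) : K) * omega b))
  val_inv := by
    obtain ⟨s, hs, hts⟩ := exists_mul_omega_mul_mul_omega_eq (K := K) hb hpc (Y := k * c)
      (Y' := k * c) (dvd_mul_left _ _) (dvd_mul_left _ _)
    exact kerFrac_mul_kerFrac_neg hd (intCast_mul_omega_mem b hb (dvd_mul_left _ _)) hs hts
  inv_val := by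
    obtain ⟨s, hs, hts⟩ := exists_mul_omega_mul_mul_omega_eq (K := K) hb hpc (Y := k * c)
      (Y' := k * c) (dvd_mul_left _ _) (dvd_mul_left _ _)
    rw [mul_comm]
    exact kerFrac_mul_kerFrac_neg hd (intCast_mul_omega_mem b hb (dvd_mul_left _ _)) hs hts

/-- The underlying fractional ideal of `kerUnit`. [cite: Cox2013, §7.D Thm. 7.24, (7.27)] -/
theorem coe_kerUnit (b : Basis (Fin 2) ℤ (𝓞 K)) (hb : b 0 = 1) {p : ℕ} (hpc : p ∣ c)
    (hd : d = c * p) (k : ℤ) :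
    ((kerUnit b hb hpc hd k : (FractionalIdeal (quadOrder K d)⁰ K)ˣ) : FractionalIdeal _ K) =
      kerFrac (Dvd.intro p hd.symm) p (((k * c : ℤ) : K) * omega b) := rfl

/-- `𝔞_k · 𝒪_c = 𝒪_c`. [cite: Cox2013, §7.D Thm. 7.24 (7.25)–(7.27), Cor. 7.28] -/
theorem kerUnit_mul_upFrac (b : Basis (Fin 2) ℤ (𝓞 K)) (hb : b 0 = 1) {p : ℕ} (hpc : p ∣ c)
    (hd : d = c * p) (k : ℤ) :
    (kerUnit b hb hpc hd k : FractionalIdeal (quadOrder K d)⁰ K) * upFrac (Dvd.intro p hd.symm) =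
      upFrac (Dvd.intro p hd.symm) := by
  obtain ⟨s, hs, hts⟩ := exists_mul_omega_mul_mul_omega_eq (K := K) hb hpc (Y := k * c)
    (Y' := k * c) (dvd_mul_left _ _) (dvd_mul_left _ _)
  exact kerFrac_mul_upFrac _ (intCast_mul_omega_mem b hb (dvd_mul_left _ _)) hs hts

/-- The lattice of `upFrac` is `𝒪_c`. [folklore] -/
private theorem fracIdealLattice_upFrac (h : c ∣ d) :
    fracIdealLattice d (upFrac (K := K) h) = Subalgebra.toSubmodule (quadOrder K c) := by
  ext x
  rw [mem_fracIdealLattice_iff, mem_upFrac_iff, Subalgebra.mem_toSubmodule]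

omit [NumberField K] [NeZero d] in
/-- `fracIdealLattice` is injective. [folklore] -/
private theorem fracIdealLattice_injective (e : ℕ) : Function.Injective (fracIdealLattice (K := K) e) := by
  intro I J hIJ
  ext x
  rw [← mem_fracIdealLattice_iff, hIJ, mem_fracIdealLattice_iff]

variable [NeZero c]

/-- The inclusion `𝒪_d ⊆ 𝒪_c` (`c ∣ d`) as an algebra structure: a definition applied locally with
`letI` (as inside `picRes`), never an instance. [folklore] -/
@[reducible] def inclAlg (h : c ∣ d) : Algebra (quadOrder K d) (quadOrder K c) :=
  (Subalgebra.inclusion (quadOrder_le_of_dvd h)).toRingHom.toAlgebra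

omit [NumberField K] [NeZero d] [NeZero c] in
/-- `𝒪_c` has no `𝒪_d`-torsion (both sit in the field `K`). [folklore] -/
private theorem noZeroSMulDivisors_inclAlg (h : c ∣ d) :
    @NoZeroSMulDivisors (quadOrder K d) (quadOrder K c) _ _ (inclAlg h).toSMul :=
  letI : Algebra (quadOrder K d) (quadOrder K c) := inclAlg h
  ⟨fun {a b} hab => by
    have hab' : ((a : K) * (b : K)) = 0 := congrArg Subtype.val hab
    rcases mul_eq_zero.mp hab' with h0 | h0
    · exact Or.inl (Subtype.ext h0)
    · exact Or.inr (Subtype.ext h0)⟩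

variable (K) in
/-- **Extension of fractional ideals `𝔞 ↦ 𝔞𝒪_c`** from `𝒪_d` to `𝒪_c` (`c ∣ d`), inside `K`:
Mathlib's `FractionalIdeal.extendedHom` along the inclusion `𝒪_d ⊆ 𝒪_c` (the algebra structure
`inclAlg` is supplied locally, as in `picRes`). [folklore] -/
def extFrac (h : c ∣ d) : FractionalIdeal (quadOrder K d)⁰ K →+* FractionalIdeal (quadOrder K c)⁰ K :=
  letI : Algebra (quadOrder K d) (quadOrder K c) := inclAlg h
  haveI : NoZeroSMulDivisors (quadOrder K d) (quadOrder K c) := noZeroSMulDivisors_inclAlg h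
  FractionalIdeal.extendedHom K (quadOrder K c)

/-- **`𝔞𝒪_c` is the `𝒪_c`-span of `𝔞`**: membership in `extFrac`. [cite: BertoliniDarmon1996, §2.4–2.5] -/
theorem mem_extFrac_iff (h : c ∣ d) {I : FractionalIdeal (quadOrder K d)⁰ K} {x : K} :
    x ∈ extFrac K h I ↔ x ∈ Submodule.span (quadOrder K c) (I : Set K) := by
  unfold extFrac
  rw [FractionalIdeal.extendedHom'_apply, FractionalIdeal.mem_extended_iff]
  have hg : ∀ hf, IsLocalization.map (M := (quadOrder K d)⁰) (S := K) (T := (quadOrder K c)⁰) K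
      (@algebraMap (quadOrder K d) (quadOrder K c) _ _ (inclAlg h)) hf = RingHom.id K := fun hf =>
    IsLocalization.ringHom_ext (quadOrder K d)⁰
      (by rw [IsLocalization.map_comp]; exact RingHom.ext fun y => rfl)
  rw [hg, RingHom.coe_id, Set.image_id]

variable (K) in
/-- Extension on invertible ideals: `(FractionalIdeal 𝒪_d)ˣ → (FractionalIdeal 𝒪_c)ˣ`. [folklore] -/
def extUnits (h : c ∣ d) :
    (FractionalIdeal (quadOrder K d)⁰ K)ˣ →* (FractionalIdeal (quadOrder K c)⁰ K)ˣ :=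
  Units.map (extFrac K h).toMonoidHom

/-- The underlying fractional ideal of `extUnits h 𝔞` is `extFrac h 𝔞`. [cite: BertoliniDarmon1996, §2.4–2.5] -/
@[simp] theorem coe_extUnits (h : c ∣ d) (𝔞 : (FractionalIdeal (quadOrder K d)⁰ K)ˣ) :
    ((extUnits K h 𝔞 : (FractionalIdeal (quadOrder K c)⁰ K)ˣ) : FractionalIdeal _ K) = extFrac K h 𝔞 :=
  rfl

/-- Compatibility of extension of fractional ideals with change of the field of fractions
(`FractionalIdeal.canonicalEquiv`): extending then transporting equals transporting then
extending. (Mathlib states `ClassGroup.extendedHom` in `FractionRing`; our ideals live in `K`.) [folklore] -/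
private theorem extendedHom_canonicalEquiv {A B F F' L L' : Type*} [CommRing A] [IsDomain A] [CommRing B]
    [IsDomain B] [Algebra A B] [Module.IsTorsionFree A B] [Field F] [Algebra A F] [IsFractionRing A F]
    [Field F'] [Algebra A F'] [IsFractionRing A F'] [Field L] [Algebra B L] [IsFractionRing B L]
    [Field L'] [Algebra B L'] [IsFractionRing B L'] (I : FractionalIdeal A⁰ F) :
    FractionalIdeal.extendedHom L' B (FractionalIdeal.canonicalEquiv A⁰ F F' I) =
      FractionalIdeal.canonicalEquiv B⁰ L L' (FractionalIdeal.extendedHom L B I) := by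
  -- the `B`-linear map `L → L'` underlying `canonicalEquiv B⁰ L L'`
  have h₁ : A⁰ ≤ Submonoid.comap (algebraMap A B) B⁰ :=
    nonZeroDivisors_le_comap_nonZeroDivisors_of_injective _ (FaithfulSMul.algebraMap_injective _ _)
  have h₀ : A⁰ ≤ Submonoid.comap (RingHom.id A) A⁰ := fun _ hy => hy
  have h₃ : B⁰ ≤ Submonoid.comap (RingHom.id B) B⁰ := fun _ hy => hy
  let g : L →ₗ[B] L' :=
    { toFun := IsLocalization.map (S := L) (T := B⁰) L' (RingHom.id B) h₃
      map_add' := fun x y => map_add _ x y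
      map_smul' := fun r x => by
        rw [RingHom.id_apply, IsLocalization.map_smul, RingHom.id_apply] }
  ext x
  rw [FractionalIdeal.extendedHom'_apply, FractionalIdeal.mem_extended_iff,
    FractionalIdeal.mem_canonicalEquiv_apply]
  have hce : ((FractionalIdeal.canonicalEquiv A⁰ F F' I : FractionalIdeal A⁰ F') : Set F') =
      (IsLocalization.map (S := F) (T := A⁰) F' (RingHom.id A) h₀) '' (I : Set F) := by
    ext y
    simp only [SetLike.mem_coe, FractionalIdeal.mem_canonicalEquiv_apply, Set.mem_image]
  have hrhs : (∃ y ∈ FractionalIdeal.extendedHom L B I,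
      IsLocalization.map (S := L) (T := B⁰) L' (RingHom.id B) h₃ y = x) ↔
      x ∈ Submodule.map g (FractionalIdeal.extendedHom L B I : Submodule B L) := by
    rw [Submodule.mem_map]; rfl
  rw [hrhs, FractionalIdeal.extendedHom'_apply, FractionalIdeal.coe_extended_eq_span,
    Submodule.map_span, hce, Set.image_image, Set.image_image]
  have hF : ∀ y : F, IsLocalization.map (S := F') (T := B⁰) L' (algebraMap A B) h₁
        (IsLocalization.map (S := F) (T := A⁰) F' (RingHom.id A) h₀ y) =
      g (IsLocalization.map (S := F) (T := B⁰) L (algebraMap A B) h₁ y) := by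
    intro y
    have : ((IsLocalization.map (S := F') (T := B⁰) L' (algebraMap A B) h₁).comp
        (IsLocalization.map (S := F) (T := A⁰) F' (RingHom.id A) h₀)) =
        (IsLocalization.map (S := L) (T := B⁰) L' (RingHom.id B) h₃).comp
          (IsLocalization.map (S := F) (T := B⁰) L (algebraMap A B) h₁) := by
      apply IsLocalization.ringHom_ext A⁰
      ext z
      simp only [RingHom.comp_apply, IsLocalization.map_eq, RingHom.id_apply]
    exact RingHom.congr_fun this y
  simp_rw [hF]

/-- **`picRes [𝔞] = [𝔞𝒪_c]` on representatives in `K`.** [cite: BertoliniDarmon1996, §2.4–2.5] -/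
theorem picRes_mk (h : c ∣ d) (𝔞 : (FractionalIdeal (quadOrder K d)⁰ K)ˣ) :
    picRes K h (ClassGroup.mk K 𝔞) = ClassGroup.mk K (extUnits K h 𝔞) := by
  letI : Algebra (quadOrder K d) (quadOrder K c) := inclAlg h
  haveI : NoZeroSMulDivisors (quadOrder K d) (quadOrder K c) := noZeroSMulDivisors_inclAlg h
  unfold picRes extUnits extFrac
  rw [ClassGroup.mk_def, ClassGroup.mk_def, QuotientGroup.mk'_apply, QuotientGroup.mk'_apply,
    ClassGroup.extendedHom_quotientMk]
  congr 1
  ext1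
  simp only [Units.coe_map, MonoidHom.coe_coe, RingHom.toMonoidHom_eq_coe]
  exact extendedHom_canonicalEquiv _

/-- **The lattice of `𝔞𝒪_c` is `𝔞 · 𝒪_c`.** [cite: BertoliniDarmon1996, §2.3 (4), §2.4] -/
theorem fracIdealLattice_extFrac (h : c ∣ d) (I : FractionalIdeal (quadOrder K d)⁰ K) :
    fracIdealLattice c (extFrac K h I) = fracIdealLattice d I * Subalgebra.toSubmodule (quadOrder K c) := by
  apply le_antisymm
  · intro x hx
    rw [mem_fracIdealLattice_iff, mem_extFrac_iff] at hx
    refine Submodule.span_induction ?_ ?_ ?_ ?_ hx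
    · intro y hy
      rw [← mul_one y]
      exact Submodule.mul_mem_mul ((mem_fracIdealLattice_iff).mpr hy) (Subalgebra.one_mem _)
    · exact zero_mem _
    · intro y z _ _ hy hz; exact add_mem hy hz
    · intro a y _ hy
      change (a : K) * y ∈ _
      rw [mul_comm (a : K) y]
      have := Submodule.mul_mem_mul hy ((Subalgebra.mem_toSubmodule _).mpr a.2 :
        (a : K) ∈ Subalgebra.toSubmodule (quadOrder K c))
      rwa [mul_assoc, Subalgebra.mul_toSubmodule, sup_idem] at this
  · rw [Submodule.mul_le]
    intro y hy z hz
    rw [mem_fracIdealLattice_iff, mem_extFrac_iff, mul_comm]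
    exact Submodule.smul_mem _ (⟨z, hz⟩ : quadOrder K c) (Submodule.subset_span hy)

/-- **`𝔞𝒪_c = 𝒪_c` iff `𝔞 · upFrac = upFrac`** (extension is trivial iff `𝔞 𝒪_c = 𝒪_c` in `K`). [cite: BertoliniDarmon1996, §2.3 (4), §2.4] -/
theorem extFrac_eq_one_iff (h : c ∣ d) (I : FractionalIdeal (quadOrder K d)⁰ K) :
    extFrac K h I = 1 ↔ I * upFrac h = upFrac h := by
  rw [← (fracIdealLattice_injective c).eq_iff, ← (fracIdealLattice_injective d).eq_iff,
    fracIdealLattice_extFrac, fracIdealLattice_one, fracIdealLattice_mul, fracIdealLattice_upFrac]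

/-- The lattice of `𝔞𝒪_c` in terms of `upFrac`: `fracIdealLattice c (𝔞𝒪_c) = fracIdealLattice d (𝔞 · upFrac)`. [cite: BertoliniDarmon1996, §2.3 (4), §2.4] -/
theorem fracIdealLattice_extFrac_eq (h : c ∣ d) (I : FractionalIdeal (quadOrder K d)⁰ K) :
    fracIdealLattice c (extFrac K h I) = fracIdealLattice d (I * upFrac h) := by
  rw [fracIdealLattice_mul, fracIdealLattice_upFrac h]
  exact fracIdealLattice_extFrac h I

/-- **`[𝔞_k]` lies in the kernel**: `extUnits (kerUnit k) = 1`. [cite: Cox2013, §7.D Thm. 7.24 (7.25)–(7.27), Cor. 7.28] -/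
theorem extUnits_kerUnit (b : Basis (Fin 2) ℤ (𝓞 K)) (hb : b 0 = 1) {p : ℕ} (hpc : p ∣ c)
    (hd : d = c * p) (k : ℤ) : extUnits K (Dvd.intro p hd.symm) (kerUnit b hb hpc hd k) = 1 := by
  ext1
  rw [coe_extUnits, Units.val_one, extFrac_eq_one_iff]
  exact kerUnit_mul_upFrac b hb hpc hd k

/-- **`picRes [𝔞_k] = 1`.** [cite: Cox2013, §7.D Thm. 7.24 (7.25)–(7.27), Cor. 7.28] -/
theorem picRes_mk_kerUnit (b : Basis (Fin 2) ℤ (𝓞 K)) (hb : b 0 = 1) {p : ℕ} (hpc : p ∣ c)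
    (hd : d = c * p) (k : ℤ) :
    picRes K (Dvd.intro p hd.symm) (ClassGroup.mk K (kerUnit b hb hpc hd k)) = 1 := by
  rw [picRes_mk, extUnits_kerUnit, map_one]

end Ext

/-! ### §4 Surjectivity of `Pic(𝒪_{cp}) → Pic(𝒪_c)` -/

section Surj

variable {c d : ℕ} [NumberField K] [NeZero c] [NeZero d] {b : Basis (Fin 2) ℤ (𝓞 K)} (hb : b 0 = 1)
  {p : ℕ} [hp : Fact p.Prime]

/-- `ClassGroup.mk K I = ClassGroup.mk K J` iff `I` and `J` differ by a principal ideal (Mathlib has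
this for `FractionRing R` as `ClassGroup.mk_eq_mk`; here for any field of fractions). [cite: Cox2013, §7.A (C(𝒪) = I(𝒪)/P(𝒪), p. 150)] -/
theorem mk_eq_mk_iff {R : Type*} [CommRing R] [IsDomain R] {F : Type*} [Field F] [Algebra R F]
    [IsFractionRing R F] {I J : (FractionalIdeal R⁰ F)ˣ} :
    ClassGroup.mk F I = ClassGroup.mk F J ↔ ∃ x : Fˣ, I * toPrincipalIdeal R F x = J := by
  have hI : ∀ I : (FractionalIdeal R⁰ F)ˣ,
      Units.mapEquiv (↑(FractionalIdeal.canonicalEquiv R⁰ F F)) I = I := fun I =>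
    Units.ext (by simp [Units.coe_mapEquiv, FractionalIdeal.canonicalEquiv_self])
  rw [← (ClassGroup.equiv F).injective.eq_iff, ClassGroup.equiv_mk, ClassGroup.equiv_mk, hI, hI,
    QuotientGroup.mk'_eq_mk']
  simp only [MonoidHom.mem_range]
  constructor
  · rintro ⟨z, ⟨x, rfl⟩, h⟩; exact ⟨x, h⟩
  · rintro ⟨x, h⟩; exact ⟨_, ⟨x, rfl⟩, h⟩

/-- The class of a principal unit ideal is trivial. [cite: Cox2013, §7.A (C(𝒪) = I(𝒪)/P(𝒪), p. 150)] -/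
theorem mk_toPrincipalIdeal {R : Type*} [CommRing R] [IsDomain R] {F : Type*} [Field F] [Algebra R F]
    [IsFractionRing R F] (x : Fˣ) : ClassGroup.mk F (toPrincipalIdeal R F x) = 1 := by
  rw [← map_one (ClassGroup.mk F), mk_eq_mk_iff]
  exact ⟨x⁻¹, by rw [← map_mul, mul_inv_cancel, map_one]⟩

include hb in
/-- **Coprime representatives**: every class of `Pic(𝒪_c)` contains an integral ideal `𝔟₁ ⊆ 𝒪_c`
with an element `β ∈ 𝔟₁ ∖ 𝔪` (i.e. `𝔟₁ + p𝒪_c = 𝒪_c`): if all products `x y`, `x ∈ 𝔟`, `y ∈ 𝔟⁻¹`,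
lay in `𝔪` then so would `1 ∈ 𝔟𝔟⁻¹`. [cite: Cox2013, §7.C Cor. 7.17] -/
theorem exists_mk_eq_le_one_not_inM (𝔟 : (FractionalIdeal (quadOrder K c)⁰ K)ˣ) :
    ∃ 𝔟₁ : (FractionalIdeal (quadOrder K c)⁰ K)ˣ, ClassGroup.mk K 𝔟₁ = ClassGroup.mk K 𝔟 ∧
      (𝔟₁ : FractionalIdeal (quadOrder K c)⁰ K) ≤ 1 ∧
      ∃ β ∈ (𝔟₁ : FractionalIdeal (quadOrder K c)⁰ K), ¬ InM b c p β := by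
  have h1 : (1 : K) ∈ ((𝔟 : FractionalIdeal (quadOrder K c)⁰ K) *
      ((𝔟⁻¹ : (FractionalIdeal (quadOrder K c)⁰ K)ˣ) : FractionalIdeal (quadOrder K c)⁰ K)) := by
    rw [Units.mul_inv]; exact FractionalIdeal.one_mem_one _
  have key : ∃ x ∈ (𝔟 : FractionalIdeal (quadOrder K c)⁰ K),
      ∃ y ∈ ((𝔟⁻¹ : (FractionalIdeal (quadOrder K c)⁰ K)ˣ) : FractionalIdeal (quadOrder K c)⁰ K),
        ¬ InM b c p (x * y) := by
    by_contra! H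
    exact not_inM_one hb hp.out (FractionalIdeal.mul_induction_on h1 H fun _ _ hx hy => hx.add hy)
  obtain ⟨x, hx, y, hy, hxy⟩ := key
  have hy0 : y ≠ 0 := by rintro rfl; exact hxy (by rw [mul_zero]; exact InM.zero)
  refine ⟨toPrincipalIdeal (quadOrder K c) K (Units.mk0 y hy0) * 𝔟, ?_, ?_, y * x, ?_, ?_⟩
  · rw [map_mul, mk_toPrincipalIdeal, one_mul]
  · rw [Units.val_mul, coe_toPrincipalIdeal, Units.val_mk0, FractionalIdeal.mul_le]
    intro y' hy' z hz
    obtain ⟨u, rfl⟩ := (FractionalIdeal.mem_spanSingleton _).mp hy'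
    rw [Algebra.smul_def, mul_assoc, ← Algebra.smul_def]
    have hyz : y * z ∈ (1 : FractionalIdeal (quadOrder K c)⁰ K) := by
      rw [← 𝔟.inv_mul]; exact FractionalIdeal.mul_mem_mul hy hz
    exact Submodule.smul_mem _ u hyz
  · rw [Units.val_mul, coe_toPrincipalIdeal, Units.val_mk0]
    exact FractionalIdeal.mul_mem_mul (FractionalIdeal.mem_spanSingleton_self _ y) hx
  · rwa [mul_comm]

include hb in
/-- **Lifting a coprime integral ideal**: if `𝔟₁ ⊆ 𝒪_c` is an invertible ideal with an element
`β ∈ 𝔟₁ ∖ 𝔪`, then `𝔞 := β'𝒪_d + p𝔟₁` (`β' ∈ 𝔟₁`, `β' ≡ 1 mod p²𝒪_c`) is an invertible `𝒪_d`-ideal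
with inverse `𝒪_d + p𝔟₁⁻¹` and `𝔞𝒪_c = 𝔟₁` (`d = cp`). [cite: Cox2013, §7.C Prop. 7.20, §7.D (7.27)] -/
theorem exists_extUnits_eq (hpc : p ∣ c) (hd : d = c * p) (𝔟₁ : (FractionalIdeal (quadOrder K c)⁰ K)ˣ)
    (hle : (𝔟₁ : FractionalIdeal (quadOrder K c)⁰ K) ≤ 1) {β : K}
    (hβ : β ∈ (𝔟₁ : FractionalIdeal (quadOrder K c)⁰ K)) (hβm : ¬ InM b c p β) :
    ∃ 𝔞 : (FractionalIdeal (quadOrder K d)⁰ K)ˣ, extUnits K (Dvd.intro p hd.symm) 𝔞 = 𝔟₁ := by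
  have h : c ∣ d := Dvd.intro p hd.symm
  set B : FractionalIdeal (quadOrder K c)⁰ K := (𝔟₁ : FractionalIdeal (quadOrder K c)⁰ K) with hB
  set B' : FractionalIdeal (quadOrder K c)⁰ K :=
    ((𝔟₁⁻¹ : (FractionalIdeal (quadOrder K c)⁰ K)ˣ) : FractionalIdeal (quadOrder K c)⁰ K) with hB'
  have hBO : ∀ x ∈ B, x ∈ quadOrder K c := fun x hx => by
    obtain ⟨x', rfl⟩ := (FractionalIdeal.mem_one_iff _).mp (hle hx); exact x'.2
  have hBB' : ∀ x ∈ B, ∀ y ∈ B', x * y ∈ quadOrder K c := fun x hx y hy => by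
    have : x * y ∈ (1 : FractionalIdeal (quadOrder K c)⁰ K) := by
      rw [← 𝔟₁.mul_inv]; exact FractionalIdeal.mul_mem_mul hx hy
    obtain ⟨z, hz⟩ := (FractionalIdeal.mem_one_iff _).mp this
    rw [← hz]; exact z.2
  -- `β' = β w (1 - p z) = 1 - p² z² ∈ 𝔟₁`
  obtain ⟨X, Y, hX, hY, hβe⟩ := (inM_or_exists_coords hb (hBO β hβ)).resolve_left hβm
  obtain ⟨w, hw, z, hz, hwz⟩ := exists_mul_eq_one_add_of_not_dvd (K := K) hb hp.out hpc hX hY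
  rw [← hβe] at hwz
  set β' : K := β * (w * (1 - (p : K) * z)) with hβ'
  have hβ'e : β' = 1 - (p : K) * ((p : K) * (z * z)) := by
    rw [hβ', ← mul_assoc, hwz]; ring
  have hβ'B : β' ∈ B := by
    have := Submodule.smul_mem (B : Submodule (quadOrder K c) K)
      (⟨w * (1 - (p : K) * z), Subalgebra.mul_mem _ hw (Subalgebra.sub_mem _ (Subalgebra.one_mem _)
        (Subalgebra.mul_mem _ (Subalgebra.natCast_mem _ p) hz))⟩ : quadOrder K c) hβ
    rw [hβ', mul_comm]; exact this
  have hpzz : (p : K) * ((p : K) * (z * z)) ∈ quadOrder K d :=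
    natCast_mul_mem_quadOrder_of_eq_mul hd (Subalgebra.mul_mem _ (Subalgebra.natCast_mem _ p)
      (Subalgebra.mul_mem _ hz hz))
  have hβ'O : β' ∈ quadOrder K d := by
    rw [hβ'e]; exact Subalgebra.sub_mem _ (Subalgebra.one_mem _) hpzz
  -- the ideal `𝔞 = β'𝒪_d + p 𝔟₁` and its inverse `𝒪_d + p 𝔟₁⁻¹`
  let A : FractionalIdeal (quadOrder K d)⁰ K :=
    FractionalIdeal.spanSingleton _ β' + FractionalIdeal.spanSingleton _ (p : K) * resFrac h B
  let A' : FractionalIdeal (quadOrder K d)⁰ K :=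
    1 + FractionalIdeal.spanSingleton _ (p : K) * resFrac h B'
  have hmemA : ∀ {x : K}, x ∈ A ↔ ∃ u ∈ quadOrder K d, ∃ r ∈ B, x = u * β' + (p : K) * r := by
    intro x
    rw [FractionalIdeal.mem_add]
    constructor
    · rintro ⟨i, hi, j, hj, rfl⟩
      obtain ⟨u, rfl⟩ := (FractionalIdeal.mem_spanSingleton _).mp hi
      obtain ⟨r, hr, rfl⟩ := FractionalIdeal.mem_singleton_mul.mp hj
      exact ⟨u, u.2, r, hr, by rw [Algebra.smul_def]; rfl⟩
    · rintro ⟨u, hu, r, hr, rfl⟩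
      exact ⟨_, (FractionalIdeal.mem_spanSingleton _).mpr ⟨⟨u, hu⟩, rfl⟩, _,
        FractionalIdeal.mem_singleton_mul.mpr ⟨r, hr, rfl⟩, by rw [Algebra.smul_def]; rfl⟩
  have hmemA' : ∀ {x : K}, x ∈ A' ↔ ∃ v ∈ quadOrder K d, ∃ r' ∈ B', x = v + (p : K) * r' := by
    intro x
    rw [FractionalIdeal.mem_add]
    constructor
    · rintro ⟨i, hi, j, hj, rfl⟩
      obtain ⟨v, rfl⟩ := (FractionalIdeal.mem_one_iff _).mp hi
      obtain ⟨r, hr, rfl⟩ := FractionalIdeal.mem_singleton_mul.mp hj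
      exact ⟨v, v.2, r, hr, rfl⟩
    · rintro ⟨v, hv, r, hr, rfl⟩
      exact ⟨v, (FractionalIdeal.mem_one_iff _).mpr ⟨⟨v, hv⟩, rfl⟩, _,
        FractionalIdeal.mem_singleton_mul.mpr ⟨r, hr, rfl⟩, rfl⟩
  have hAA' : A * A' = 1 := by
    apply le_antisymm
    · rw [FractionalIdeal.mul_le]
      intro i hi j hj
      obtain ⟨u, hu, r, hr, rfl⟩ := hmemA.mp hi
      obtain ⟨v, hv, r', hr', rfl⟩ := hmemA'.mp hj
      rw [FractionalIdeal.mem_one_iff]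
      have e : (u * β' + (p : K) * r) * (v + (p : K) * r') =
          u * v * β' + u * ((p : K) * (β' * r')) + v * ((p : K) * r) +
            (p : K) * ((p : K) * (r * r')) := by ring
      rw [e]
      refine ⟨⟨_, ?_⟩, rfl⟩
      refine Subalgebra.add_mem _ (Subalgebra.add_mem _ (Subalgebra.add_mem _
        (Subalgebra.mul_mem _ (Subalgebra.mul_mem _ hu hv) hβ'O)
        (Subalgebra.mul_mem _ hu (natCast_mul_mem_quadOrder_of_eq_mul hd (hBB' _ hβ'B _ hr'))))
        (Subalgebra.mul_mem _ hv (natCast_mul_mem_quadOrder_of_eq_mul hd (hBO _ hr)))) ?_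
      exact natCast_mul_mem_quadOrder_of_eq_mul hd (Subalgebra.mul_mem _ (Subalgebra.natCast_mem _ p)
        (hBB' _ hr _ hr'))
    · rw [FractionalIdeal.one_le]
      -- `1 = β' · 1 + p² z²`, and `p² z² ∈ (p𝔟₁)(p𝔟₁⁻¹)` since `z² ∈ 𝒪_c = 𝔟₁𝔟₁⁻¹`
      have hzz : z * z ∈ resFrac h B * resFrac h B' := by
        rw [← resFrac_mul, hB, hB', ← Units.val_mul, mul_inv_cancel, Units.val_one]
        change z * z ∈ upFrac h
        exact (mem_upFrac_iff h).mpr (Subalgebra.mul_mem _ hz hz)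
      have hpzz' : (p : K) * ((p : K) * (z * z)) ∈ A * A' := by
        refine FractionalIdeal.mul_induction_on hzz (fun i hi j hj => ?_) (fun x y hx hy => ?_)
        · have e : (p : K) * ((p : K) * (i * j)) = ((p : K) * i) * ((p : K) * j) := by ring
          rw [e]
          exact FractionalIdeal.mul_mem_mul (hmemA.mpr ⟨0, Subalgebra.zero_mem _, i, hi, by ring⟩)
            (hmemA'.mpr ⟨0, Subalgebra.zero_mem _, j, hj, by ring⟩)
        · have e : (p : K) * ((p : K) * (x + y)) = (p : K) * ((p : K) * x) + (p : K) * ((p : K) * y) := by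
            ring
          rw [e]; exact add_mem_fi hx hy
      have e1 : (1 : K) = β' * 1 + (p : K) * ((p : K) * (z * z)) := by rw [hβ'e]; ring
      rw [e1]
      exact add_mem_fi (FractionalIdeal.mul_mem_mul (hmemA.mpr ⟨1, Subalgebra.one_mem _, 0,
        zero_mem_fi, by ring⟩) (hmemA'.mpr ⟨1, Subalgebra.one_mem _, 0, zero_mem_fi, by ring⟩)) hpzz'
  let 𝔞 : (FractionalIdeal (quadOrder K d)⁰ K)ˣ := ⟨A, A', hAA', by rw [mul_comm]; exact hAA'⟩
  refine ⟨𝔞, Units.ext ?_⟩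
  rw [coe_extUnits]
  change extFrac K h A = B
  ext x
  rw [mem_extFrac_iff]
  constructor
  · intro hx
    refine (Submodule.span_le (p := (B : Submodule (quadOrder K c) K)) |>.mpr ?_) hx
    intro y hy
    obtain ⟨u, hu, r, hr, rfl⟩ := hmemA.mp hy
    have h1 : u * β' ∈ B := by
      have := Submodule.smul_mem (B : Submodule (quadOrder K c) K)
        (⟨u, quadOrder_le_of_dvd h hu⟩ : quadOrder K c) hβ'B
      exact this
    have h2 : (p : K) * r ∈ B :=
      Submodule.smul_mem (B : Submodule (quadOrder K c) K) (⟨(p : K), Subalgebra.natCast_mem _ p⟩ :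
        quadOrder K c) hr
    exact add_mem h1 h2
  · intro hx
    -- `x = x β' + (p z²) (p x)`
    have e : x = x * β' + ((p : K) * (z * z)) * ((p : K) * x) := by rw [hβ'e]; ring
    rw [e]
    refine add_mem (Submodule.smul_mem _ (⟨x, hBO x hx⟩ : quadOrder K c)
      (Submodule.subset_span (hmemA.mpr ⟨1, Subalgebra.one_mem _, 0, zero_mem_fi, by ring⟩)))
      (Submodule.smul_mem _ (⟨(p : K) * (z * z), Subalgebra.mul_mem _ (Subalgebra.natCast_mem _ p)
        (Subalgebra.mul_mem _ hz hz)⟩ : quadOrder K c)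
        (Submodule.subset_span (hmemA.mpr ⟨0, Subalgebra.zero_mem _, x, hx, by ring⟩)))

/-- **`Pic(𝒪_{cp}) → Pic(𝒪_c)` is surjective** (`K` quadratic, `p ∣ c` prime): BD96 §2.3 (the
projections `G_{n+1} → G_n` of ring class groups are onto), Cox (7.25)–(7.27). [cite: BertoliniDarmon1996, §2.3] -/
theorem picRes_surjective (h2 : Module.finrank ℚ K = 2) (hpc : p ∣ c) (hd : d = c * p) :
    Function.Surjective (picRes K (Dvd.intro p hd.symm : c ∣ d)) := by
  obtain ⟨b, hb⟩ := exists_basis_zero_eq_one (K := K) h2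
  intro τ
  refine ClassGroup.induction (K := K) (fun 𝔟 => ?_) τ
  obtain ⟨𝔟₁, h𝔟₁, hle, β, hβ, hβm⟩ := exists_mk_eq_le_one_not_inM (c := c) hb (p := p) 𝔟
  obtain ⟨𝔞, h𝔞⟩ := exists_extUnits_eq hb hpc hd 𝔟₁ hle hβ hβm
  exact ⟨ClassGroup.mk K 𝔞, by rw [picRes_mk, h𝔞, h𝔟₁]⟩

end Surj

/-! ### §5 The kernel of `Pic(𝒪_{cp}) → Pic(𝒪_c)` is `{[𝔞_k] : 0 ≤ k < p}` -/

section Kernel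

variable {c d : ℕ} [NumberField K] [NeZero c] [NeZero d] {b : Basis (Fin 2) ℤ (𝓞 K)} (hb : b 0 = 1)
  {p : ℕ} [hp : Fact p.Prime]

omit [NeZero c] [NeZero d] hp in
/-- **The units of `𝒪_c = ℤ + c𝓞_K` are `±1` for `c ≥ 2`** (`K` imaginary quadratic; universe
polymorphic restatement of `CaiShuTian2014.coe_units_quadOrder_eq_one_or_eq_neg_one`, same proof:
the norm form `X² + tXY − mY²` with `4N = (2X + tY)² − d_K Y²`, `d_K ≤ −3`, `c² ≥ 4`). [cite: Cox2013, §7.A] -/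
theorem coe_units_quadOrder_eq_one_or_eq_neg_one (hK : IsImaginaryQuadratic K) (hc : 2 ≤ c)
    (u : (quadOrder K c)ˣ) :
    ((u : quadOrder K c) : K) = 1 ∨ ((u : quadOrder K c) : K) = -1 := by
  obtain ⟨b, hb⟩ := exists_basis_zero_eq_one (K := K) hK.1
  set m : ℤ := b.repr (b 1 * b 1) 0 with hm
  set t : ℤ := b.repr (b 1 * b 1) 1 with ht
  have hω : b 1 * b 1 = (m : 𝓞 K) + (t : 𝓞 K) * b 1 := basis_one_mul_self_eq b hb
  have hD : NumberField.discr K = t ^ 2 + 4 * m := discr_eq_sq_add_four_mul b hb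
  have hneg : NumberField.discr K < 0 := hK.discr_neg
  have h4 : NumberField.discr K % 4 = 0 ∨ NumberField.discr K % 4 = 1 := discr_emod_four hK.1
  have hd3 : NumberField.discr K ≤ -3 := by omega
  have hdec : ∀ x : K, x ∈ quadOrder K c → ∃ X Y : ℤ, (c : ℤ) ∣ Y ∧
      algebraMap (𝓞 K) K ((X : 𝓞 K) + (Y : 𝓞 K) * b 1) = x := by
    intro x hx
    obtain ⟨X, Y, hY, rfl⟩ := (mem_quadOrder_iff_coords b hb).mp hx
    exact ⟨X, Y, hY, by simp [omega]⟩
  obtain ⟨X, Y, hcY, hz⟩ := hdec _ (u : quadOrder K c).2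
  obtain ⟨X', Y', -, hz'⟩ := hdec _ ((u⁻¹ : (quadOrder K c)ˣ) : quadOrder K c).2
  set z : 𝓞 K := (X : 𝓞 K) + (Y : 𝓞 K) * b 1 with hzdef
  set z' : 𝓞 K := (X' : 𝓞 K) + (Y' : 𝓞 K) * b 1 with hz'def
  have hzz' : z * z' = 1 := by
    apply IsFractionRing.injective (𝓞 K) K
    rw [map_mul, map_one, hz, hz', ← Subalgebra.coe_mul, Units.mul_inv, OneMemClass.coe_one]
  have hN : Algebra.norm ℤ z = X ^ 2 + t * X * Y - m * Y ^ 2 := norm_intCast_add_intCast_mul b hb hω X Y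
  have hunit : IsUnit (Algebra.norm ℤ z) := (IsUnit.of_mul_eq_one z' hzz').map (Algebra.norm ℤ)
  have hid : 4 * (X ^ 2 + t * X * Y - m * Y ^ 2) =
      (2 * X + t * Y) ^ 2 - NumberField.discr K * Y ^ 2 := by rw [hD]; ring
  have hY : Y = 0 := by
    by_contra hY
    obtain ⟨k, rfl⟩ := hcY
    have hk : k ≠ 0 := fun h ↦ hY (by rw [h, mul_zero])
    have hk2 : 1 ≤ k ^ 2 := by
      rcases lt_or_gt_of_ne hk with h | h <;> nlinarith
    have hc2 : (4 : ℤ) ≤ (c : ℤ) ^ 2 := by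
      have : (2 : ℤ) ≤ c := by exact_mod_cast hc
      nlinarith
    have hY2 : 4 ≤ ((c : ℤ) * k) ^ 2 := by
      rw [mul_pow]; nlinarith
    rcases Int.isUnit_iff.mp hunit with h | h <;> rw [hN] at h <;>
      nlinarith [sq_nonneg (2 * X + t * ((c : ℤ) * k))]
  have hX : X = 1 ∨ X = -1 := by
    rw [hY] at hN
    rcases Int.isUnit_iff.mp hunit with h | h <;> rw [hN] at h
    · have h' : X ^ 2 = 1 := by linarith
      exact sq_eq_one_iff.mp (by exact_mod_cast h')
    · nlinarith [sq_nonneg X]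
  rw [← hz, hzdef, hY]
  rcases hX with h | h <;> simp [h]

omit [NeZero c] hp in
/-- Congruent parameters give the same kernel ideal: `𝔞_{t'} ⊆ 𝔞_t` if `t' − t ∈ p𝒪_c`. [folklore] -/
private theorem kerFrac_le_kerFrac_of (h : c ∣ d) {t t' m : K} (hm : m ∈ quadOrder K c)
    (htt' : t' = t + (p : K) * m) : kerFrac h p t' ≤ kerFrac h p t := by
  intro x hx
  obtain ⟨u, hu, r, hr, rfl⟩ := (mem_kerFrac_iff h).mp hx
  have e : u * (1 + t') + (p : K) * r = u * (1 + t) + (p : K) * (u * m + r) := by rw [htt']; ring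
  rw [mem_fi, FractionalIdeal.mem_coe, e]
  exact (mem_kerFrac_iff h).mpr ⟨u, hu, u * m + r,
    Subalgebra.add_mem _ (Subalgebra.mul_mem _ (quadOrder_le_of_dvd h hu) hm) hr, rfl⟩

omit [NeZero c] hp in
include hb in
/-- `𝔞_k = 𝔞_{k'}` for `k ≡ k' (mod p)`. [cite: Cox2013, §7.D Thm. 7.24, (7.27)] -/
theorem kerUnit_eq_of_dvd_sub (hpc : p ∣ c) (hd : d = c * p) {k k' : ℤ} (hkk' : (p : ℤ) ∣ k' - k) :
    kerUnit b hb hpc hd k = kerUnit b hb hpc hd k' := by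
  obtain ⟨j, hj⟩ := hkk'
  have hm : ((j * c : ℤ) : K) * omega b ∈ quadOrder K c := intCast_mul_omega_mem b hb (dvd_mul_left _ _)
  have e1 : ((k' * c : ℤ) : K) * omega b = ((k * c : ℤ) : K) * omega b + (p : K) * (((j * c : ℤ) : K) * omega b) := by
    have : (k' : K) = k + p * j := by
      have := congrArg (fun z : ℤ => (z : K)) hj; push_cast at this ⊢; linear_combination this
    push_cast; rw [this]; ring
  have e2 : ((k * c : ℤ) : K) * omega b = ((k' * c : ℤ) : K) * omega b + (p : K) * (-(((j * c : ℤ) : K) * omega b)) := by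
    rw [e1]; ring
  ext1
  rw [coe_kerUnit, coe_kerUnit]
  exact le_antisymm (kerFrac_le_kerFrac_of _ (Subalgebra.neg_mem _ hm) e2) (kerFrac_le_kerFrac_of _ hm e1)

/-- **Extension of a principal ideal is principal with the same generator**:
`(x𝒪_d)𝒪_c = x𝒪_c`. [cite: Cox2013, §7.C Prop. 7.20] -/
theorem extFrac_spanSingleton (h : c ∣ d) (a : K) :
    extFrac K h (FractionalIdeal.spanSingleton (quadOrder K d)⁰ a) =
      FractionalIdeal.spanSingleton (quadOrder K c)⁰ a := by
  ext x
  rw [mem_extFrac_iff]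
  constructor
  · intro hx
    refine (Submodule.span_le (p := ((FractionalIdeal.spanSingleton (quadOrder K c)⁰ a :
      FractionalIdeal (quadOrder K c)⁰ K) : Submodule (quadOrder K c) K))).mpr ?_ hx
    intro y hy
    obtain ⟨u, rfl⟩ := (FractionalIdeal.mem_spanSingleton _).mp hy
    exact (FractionalIdeal.mem_spanSingleton _).mpr ⟨⟨u, quadOrder_le_of_dvd h u.2⟩, rfl⟩
  · intro hx
    obtain ⟨z, rfl⟩ := (FractionalIdeal.mem_spanSingleton _).mp hx
    exact Submodule.smul_mem _ z (Submodule.subset_span (FractionalIdeal.mem_spanSingleton_self _ a))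

omit [NumberField K] [NeZero d] in
/-- `¬ (cp ∣ c)` in `ℤ` (`c ≠ 0`, `p > 1`). [folklore] -/
private theorem not_mul_dvd (hd : d = c * p) : ¬ ((d : ℤ) ∣ c) := by
  intro hdvd
  have h1 : d ∣ c := Int.natCast_dvd_natCast.mp hdvd
  have h2 : d ≤ c := Nat.le_of_dvd (NeZero.pos c) h1
  rw [hd] at h2
  have : c * 2 ≤ c * p := Nat.mul_le_mul_left c hp.out.two_le
  have hc : 0 < c := NeZero.pos c
  omega

include hb in
/-- **An invertible `𝒪_d`-ideal `𝔠` with `𝒪_d ⊆ 𝔠` and `𝔠𝒪_c = 𝒪_c` is `𝒪_d`** (`d = cp`): otherwise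
`𝔠` contains an element of `𝒪_c ∖ 𝒪_d`, hence `cω`, hence all of `𝒪_c`, so `𝔠 = 𝒪_c` would be
invertible over `𝒪_d` — impossible as `𝒪_c · 𝒪_c = 𝒪_c ≠ 𝒪_d`. [cite: Cox2013, §7.D Thm. 7.24 (7.25)–(7.27), Cor. 7.28] -/
theorem coe_units_eq_one_of_one_le (hd : d = c * p) (𝔠 : (FractionalIdeal (quadOrder K d)⁰ K)ˣ)
    (h1𝔠 : (1 : FractionalIdeal (quadOrder K d)⁰ K) ≤ 𝔠)
    (h𝔠up : (𝔠 : FractionalIdeal (quadOrder K d)⁰ K) * upFrac (Dvd.intro p hd.symm) =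
      upFrac (Dvd.intro p hd.symm)) :
    (𝔠 : FractionalIdeal (quadOrder K d)⁰ K) = 1 := by
  have h : c ∣ d := Dvd.intro p hd.symm
  have h𝔠le : (𝔠 : FractionalIdeal (quadOrder K d)⁰ K) ≤ upFrac h := fun v hv => by
    have h5 : v * 1 ∈ (𝔠 : FractionalIdeal (quadOrder K d)⁰ K) * upFrac h :=
      FractionalIdeal.mul_mem_mul hv ((mem_upFrac_iff h).mpr (Subalgebra.one_mem _))
    rw [mul_one, h𝔠up] at h5
    exact h5
  have hO_d_le : ∀ v ∈ quadOrder K d, v ∈ (𝔠 : FractionalIdeal (quadOrder K d)⁰ K) := fun v hv =>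
    h1𝔠 ((FractionalIdeal.mem_one_iff _).mpr ⟨⟨v, hv⟩, rfl⟩)
  by_contra hne
  have hex : ∃ x ∈ (𝔠 : FractionalIdeal (quadOrder K d)⁰ K), x ∉ quadOrder K d := by
    by_contra! H
    have hle1 : (𝔠 : FractionalIdeal (quadOrder K d)⁰ K) ≤ 1 := fun x hx =>
      (FractionalIdeal.mem_one_iff _).mpr ⟨⟨x, H x hx⟩, rfl⟩
    exact hne (le_antisymm hle1 h1𝔠)
  obtain ⟨x, hx𝔠, hxO⟩ := hex
  obtain ⟨X₁, Y₁, hY₁, rfl⟩ :=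
    (mem_quadOrder_iff_coords b hb).mp ((mem_upFrac_iff h).mp (h𝔠le hx𝔠))
  obtain ⟨y₁, rfl⟩ := hY₁
  have hpy : ¬ (p : ℤ) ∣ y₁ := fun hpy =>
    hxO (coords_mem_quadOrder b hb (by rw [hd]; push_cast; exact mul_dvd_mul_left _ hpy))
  obtain ⟨q₁, y₁', hq⟩ := (Prime.coprime_iff_not_dvd (Nat.prime_iff_prime_int.mp hp.out)).mpr hpy
  have hcω : (c : K) * omega b ∈ (𝔠 : FractionalIdeal (quadOrder K d)⁰ K) := by
    have e : (c : K) * omega b = (y₁' : K) * (((X₁ : K) + ((c * y₁ : ℤ) : K) * omega b) - X₁) +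
        (q₁ : K) * (((p * c : ℤ) : K) * omega b) := by
      have h1' := congrArg (fun z : ℤ => (z : K)) hq
      push_cast at h1' ⊢
      linear_combination (-((c : K) * omega b)) * h1'
    rw [e]
    refine add_mem_fi (Submodule.smul_mem _ (⟨(y₁' : K), Subalgebra.intCast_mem _ y₁'⟩ : quadOrder K d)
      (sub_mem_fi hx𝔠 (hO_d_le _ (Subalgebra.intCast_mem _ X₁)))) ?_
    exact Submodule.smul_mem _ (⟨(q₁ : K), Subalgebra.intCast_mem _ q₁⟩ : quadOrder K d)
      (hO_d_le _ (intCast_mul_omega_mem b hb (by rw [hd]; push_cast; exact dvd_of_eq (mul_comm _ _))))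
  have hup : upFrac h ≤ (𝔠 : FractionalIdeal (quadOrder K d)⁰ K) := by
    intro v hv
    obtain ⟨X₂, Y₂, ⟨y₂, rfl⟩, rfl⟩ := (mem_quadOrder_iff_coords b hb).mp ((mem_upFrac_iff h).mp hv)
    have e : (X₂ : K) + ((c * y₂ : ℤ) : K) * omega b = (X₂ : K) + (y₂ : K) * ((c : K) * omega b) := by
      push_cast; ring
    rw [mem_fi, FractionalIdeal.mem_coe, e]
    exact add_mem_fi (hO_d_le _ (Subalgebra.intCast_mem _ X₂))
      (Submodule.smul_mem _ (⟨(y₂ : K), Subalgebra.intCast_mem _ y₂⟩ : quadOrder K d) hcω)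
  have h𝔠eq : (𝔠 : FractionalIdeal (quadOrder K d)⁰ K) = upFrac h := le_antisymm h𝔠le hup
  -- `upFrac` would be invertible, but `upFrac² = upFrac`, so `upFrac = 1`, i.e. `cω ∈ 𝒪_d`: absurd
  have hup1 : upFrac (K := K) h = 1 :=
    calc upFrac h = upFrac h * (upFrac h * ((𝔠⁻¹ : (FractionalIdeal (quadOrder K d)⁰ K)ˣ) :
          FractionalIdeal _ K)) := by rw [← h𝔠eq, Units.mul_inv, mul_one]
      _ = (upFrac h * upFrac h) * ((𝔠⁻¹ : (FractionalIdeal (quadOrder K d)⁰ K)ˣ) :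
          FractionalIdeal _ K) := by rw [mul_assoc]
      _ = 1 := by rw [upFrac_mul_upFrac, ← h𝔠eq, Units.mul_inv]
  have hcωd : (c : K) * omega b ∈ quadOrder K d := by
    have hm : (c : K) * omega b ∈ upFrac (K := K) h :=
      (mem_upFrac_iff h).mpr (by exact_mod_cast intCast_mul_omega_mem b hb (dvd_refl (c : ℤ)))
    rw [hup1] at hm
    obtain ⟨v, hv⟩ := (FractionalIdeal.mem_one_iff _).mp hm
    rw [← hv]; exact v.2
  exact natCast_mul_omega_not_mem b hb (not_mul_dvd hd) hcωd

include hb in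
/-- **An invertible `𝒪_{cp}`-ideal `𝔞` with `𝔞𝒪_c = 𝒪_c` is a kernel ideal `𝔞_k`** (Cox (7.27)):
`p𝒪_c ⊆ 𝔞 ⊆ 𝒪_c`, `𝔞 ⊄ 𝔪`, so `𝔞 ∋ X + Yω` with `p ∤ X` and `𝔞 ⊇ 𝔞_k` for `k ≡ X⁻¹(Y/c)`; then
`𝔞_k⁻¹𝔞` is `𝒪_d` by `coe_units_eq_one_of_one_le`. [cite: Cox2013, §7.D Thm. 7.24 (7.25)–(7.27), Cor. 7.28] -/
theorem exists_eq_kerUnit (hpc : p ∣ c) (hd : d = c * p) (𝔞 : (FractionalIdeal (quadOrder K d)⁰ K)ˣ)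
    (h1 : (𝔞 : FractionalIdeal (quadOrder K d)⁰ K) * upFrac (Dvd.intro p hd.symm) =
      upFrac (Dvd.intro p hd.symm)) :
    ∃ k : ℤ, 𝔞 = kerUnit b hb hpc hd k := by
  have h : c ∣ d := Dvd.intro p hd.symm
  have hle : (𝔞 : FractionalIdeal (quadOrder K d)⁰ K) ≤ upFrac h := fun v hv => by
    have h5 : v * 1 ∈ (𝔞 : FractionalIdeal (quadOrder K d)⁰ K) * upFrac h :=
      FractionalIdeal.mul_mem_mul hv ((mem_upFrac_iff h).mpr (Subalgebra.one_mem _))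
    rw [mul_one, h1] at h5
    exact h5
  have hp1 : ∀ r ∈ quadOrder K c, (p : K) * r ∈ (𝔞 : FractionalIdeal (quadOrder K d)⁰ K) := by
    intro r hr
    have h5 : (p : K) * r ∈ (𝔞 : FractionalIdeal (quadOrder K d)⁰ K) * upFrac h := by
      rw [h1]; exact (mem_upFrac_iff h).mpr (Subalgebra.mul_mem _ (Subalgebra.natCast_mem _ p) hr)
    -- `p r ∈ 𝔞 𝒪_c`: write it as a sum of products `a s` and use `p (a s) = a (p s) ∈ 𝔞 𝒪_d = 𝔞`
    have key : ∀ w ∈ (𝔞 : FractionalIdeal (quadOrder K d)⁰ K) * upFrac h,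
        (p : K) * w ∈ (𝔞 : FractionalIdeal (quadOrder K d)⁰ K) := fun w hw =>
      FractionalIdeal.mul_induction_on hw
        (fun i hi j hj => by
          rw [mul_left_comm, mul_comm]
          exact Submodule.smul_mem _ (⟨(p : K) * j, natCast_mul_mem_quadOrder_of_eq_mul hd
            ((mem_upFrac_iff h).mp hj)⟩ : quadOrder K d) hi)
        (fun x y hx hy => by rw [mul_add]; exact add_mem_fi hx hy)
    -- `p r = p · (r · 1)`-trick is not needed: apply `key` to `r` itself (`r = 1 · r ∈ 𝔞𝒪_c`? only if
    -- `1 ∈ 𝔞`); instead use `p r ∈ 𝔞𝒪_c` and `p (p r) ∈ 𝔞`… we need `p r` itself, so argue via `h5`: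
    -- `p r ∈ 𝔞 𝒪_c = 𝔞 · upFrac`, and `𝔞 · upFrac ∋ w ↦ ?` — use instead the factorisation
    -- `p 𝒪_c = 𝔞 (p 𝒪_c) ⊆ 𝔞 𝒪_d = 𝔞`: `r ∈ 𝒪_c = 𝔞𝒪_c`-sum `r = Σ aᵢ sᵢ`, `p r = Σ aᵢ (p sᵢ)`.
    have hr' : r ∈ (𝔞 : FractionalIdeal (quadOrder K d)⁰ K) * upFrac h := by
      rw [h1]; exact (mem_upFrac_iff h).mpr hr
    exact key r hr'
  -- an element of `𝔞` outside `𝔪`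
  have hu : ∃ u ∈ (𝔞 : FractionalIdeal (quadOrder K d)⁰ K), ¬ InM b c p u := by
    by_contra! H
    have h1mem : (1 : K) ∈ (𝔞 : FractionalIdeal (quadOrder K d)⁰ K) * upFrac h := by
      rw [h1]; exact (mem_upFrac_iff h).mpr (Subalgebra.one_mem _)
    exact not_inM_one hb hp.out (FractionalIdeal.mul_induction_on h1mem
      (fun i hi j hj => (H i hi).mul_mem hb hpc ((mem_upFrac_iff h).mp hj)) fun _ _ hx hy => hx.add hy)
  obtain ⟨u, hu𝔞, hum⟩ := hu
  have huO : u ∈ quadOrder K c := (mem_upFrac_iff h).mp (hle hu𝔞)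
  obtain ⟨X, Y, hX, hY, rfl⟩ := (inM_or_exists_coords hb huO).resolve_left hum
  obtain ⟨q, X', hqX⟩ := (Prime.coprime_iff_not_dvd (Nat.prime_iff_prime_int.mp hp.out)).mpr hX
  obtain ⟨y, rfl⟩ := hY
  -- `k := X' y`: `1 + kcω = X' u + p q ∈ 𝔞`
  have hmem1 : (1 : K) + ((X' * y * c : ℤ) : K) * omega b ∈ (𝔞 : FractionalIdeal (quadOrder K d)⁰ K) := by
    have e : (1 : K) + ((X' * y * c : ℤ) : K) * omega b =
        (X' : K) * ((X : K) + ((c * y : ℤ) : K) * omega b) + (p : K) * (q : K) := by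
      have h1' := congrArg (fun z : ℤ => (z : K)) hqX
      push_cast at h1' ⊢
      linear_combination (-1 : K) * h1'
    rw [e]
    exact add_mem_fi (Submodule.smul_mem _ (⟨(X' : K), Subalgebra.intCast_mem _ X'⟩ : quadOrder K d) hu𝔞)
      (hp1 _ (Subalgebra.intCast_mem _ q))
  have hker_le : (kerUnit b hb hpc hd (X' * y) : FractionalIdeal (quadOrder K d)⁰ K) ≤ 𝔞 := by
    intro v hv
    obtain ⟨w, hw, r, hr, rfl⟩ := (mem_kerFrac_iff h).mp hv
    exact add_mem_fi (Submodule.smul_mem _ (⟨w, hw⟩ : quadOrder K d) hmem1) (hp1 r hr)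
  -- `𝔠 = 𝔞_k⁻¹ 𝔞` is `𝒪_d`
  have h1𝔠 : (1 : FractionalIdeal (quadOrder K d)⁰ K) ≤
      (((kerUnit b hb hpc hd (X' * y))⁻¹ * 𝔞 : (FractionalIdeal (quadOrder K d)⁰ K)ˣ) :
        FractionalIdeal (quadOrder K d)⁰ K) := by
    have := mul_le_mul_right hker_le
      (((kerUnit b hb hpc hd (X' * y))⁻¹ : (FractionalIdeal (quadOrder K d)⁰ K)ˣ) : FractionalIdeal _ K)
    rwa [Units.inv_mul, ← Units.val_mul] at this
  have h𝔠up : (((kerUnit b hb hpc hd (X' * y))⁻¹ * 𝔞 : (FractionalIdeal (quadOrder K d)⁰ K)ˣ) :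
        FractionalIdeal (quadOrder K d)⁰ K) * upFrac h = upFrac h := by
    rw [Units.val_mul, mul_assoc, h1]
    -- `𝔞_k⁻¹ 𝒪_c = 𝔞_k⁻¹ (𝔞_k 𝒪_c) = 𝒪_c`
    conv_lhs => rw [← kerUnit_mul_upFrac b hb hpc hd (X' * y), ← mul_assoc, Units.inv_mul, one_mul]
  have h𝔠 := coe_units_eq_one_of_one_le hb hd _ h1𝔠 h𝔠up
  refine ⟨X' * y, ?_⟩
  calc 𝔞 = kerUnit b hb hpc hd (X' * y) * ((kerUnit b hb hpc hd (X' * y))⁻¹ * 𝔞) := by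
        rw [mul_inv_cancel_left]
    _ = kerUnit b hb hpc hd (X' * y) := by rw [Units.val_eq_one.mp h𝔠, mul_one]

include hb in
/-- **Exhaustion of the kernel**: a class `σ ∈ Pic(𝒪_{cp})` with `σ𝒪_c` trivial is one of
`[𝔞_0], …, [𝔞_{p−1}]`: normalise a representative `𝔞` of `σ` so that `𝔞𝒪_c = 𝒪_c` and apply
`exists_eq_kerUnit`, then reduce `k` modulo `p`. [cite: Cox2013, §7.D Thm. 7.24 (7.25)–(7.27), Cor. 7.28] -/
theorem exists_eq_mk_kerUnit_of_picRes_eq_one (hpc : p ∣ c) (hd : d = c * p)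
    {σ : ClassGroup (quadOrder K d)} (hσ : picRes K (Dvd.intro p hd.symm) σ = 1) :
    ∃ k : ℕ, k < p ∧ σ = ClassGroup.mk K (kerUnit b hb hpc hd k) := by
  have h : c ∣ d := Dvd.intro p hd.symm
  revert hσ
  refine ClassGroup.induction (K := K) (fun 𝔞 => ?_) σ
  intro hσ
  rw [picRes_mk, ClassGroup.mk_eq_one_iff, coe_extUnits, FractionalIdeal.isPrincipal_iff] at hσ
  obtain ⟨x, hx⟩ := hσ
  have hx0 : x ≠ 0 := by
    intro h0
    rw [h0, FractionalIdeal.spanSingleton_zero] at hx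
    exact (extUnits K h 𝔞).ne_zero hx
  -- normalise the representative: `𝔞' = x⁻¹ 𝔞` has `𝔞'𝒪_c = 𝒪_c`
  obtain ⟨𝔞', h𝔞'⟩ : ∃ 𝔞' : (FractionalIdeal (quadOrder K d)⁰ K)ˣ,
      𝔞' = toPrincipalIdeal (quadOrder K d) K (Units.mk0 x hx0)⁻¹ * 𝔞 := ⟨_, rfl⟩
  have hmk : ClassGroup.mk K 𝔞' = ClassGroup.mk K 𝔞 := by
    rw [h𝔞', map_mul, mk_toPrincipalIdeal, one_mul]
  have hext : extFrac K h (𝔞' : FractionalIdeal (quadOrder K d)⁰ K) = 1 := by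
    rw [h𝔞', Units.val_mul, RingHom.map_mul, coe_toPrincipalIdeal, extFrac_spanSingleton, hx,
      Units.val_inv_eq_inv_val, Units.val_mk0, FractionalIdeal.spanSingleton_mul_spanSingleton,
      inv_mul_cancel₀ hx0, FractionalIdeal.spanSingleton_one]
  obtain ⟨k₀, hk₀⟩ := exists_eq_kerUnit hb hpc hd 𝔞' ((extFrac_eq_one_iff h _).mp hext)
  have hp0 : (0 : ℤ) < p := by exact_mod_cast hp.out.pos
  refine ⟨(k₀ % p).toNat, ?_, ?_⟩
  · have h0 := Int.emod_nonneg k₀ hp0.ne'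
    have h1' := Int.emod_lt_of_pos k₀ hp0
    omega
  · rw [← hmk, hk₀]
    refine congrArg (ClassGroup.mk K) (kerUnit_eq_of_dvd_sub hb hpc hd ?_)
    rw [Int.toNat_of_nonneg (Int.emod_nonneg k₀ hp0.ne')]
    exact (Int.mod_modEq k₀ (p : ℤ)).symm.dvd

include hb in
/-- **No repetitions in the kernel**: `[𝔞_k] = [𝔞_{k'}]` forces `k ≡ k' (mod p)` (`K` imaginary
quadratic, so `𝒪_c^× = {±1}` as `c ≥ p ≥ 2`): from `𝔞_{k'} = x𝔞_k` with `x𝒪_c = 𝒪_c` one gets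
`x = ±1`, `1 + k'cω ∈ 𝔞_k`, and comparing `ω`-coordinates modulo `pc`. [cite: Cox2013, §7.D Thm. 7.24 (7.25)–(7.27), Cor. 7.28] -/
theorem dvd_sub_of_mk_kerUnit_eq (hK : IsImaginaryQuadratic K) (hpc : p ∣ c) (hd : d = c * p) {k k' : ℤ}
    (he : ClassGroup.mk K (kerUnit b hb hpc hd k) = ClassGroup.mk K (kerUnit b hb hpc hd k')) :
    (p : ℤ) ∣ k' - k := by
  have h : c ∣ d := Dvd.intro p hd.symm
  have hc2 : 2 ≤ c := le_trans hp.out.two_le (Nat.le_of_dvd (NeZero.pos c) hpc)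
  obtain ⟨x, hx⟩ := mk_eq_mk_iff.mp he
  have hx1 : FractionalIdeal.spanSingleton (quadOrder K c)⁰ (x : K) = 1 := by
    have h2 := congrArg (extUnits K h) hx
    rw [map_mul, extUnits_kerUnit, extUnits_kerUnit, one_mul] at h2
    have h3 := congrArg Units.val h2
    rwa [coe_extUnits, coe_toPrincipalIdeal, extFrac_spanSingleton, Units.val_one] at h3
  have hxO : (x : K) ∈ quadOrder K c := by
    have h2 : (x : K) ∈ FractionalIdeal.spanSingleton (quadOrder K c)⁰ (x : K) :=
      FractionalIdeal.mem_spanSingleton_self _ _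
    rw [hx1] at h2
    obtain ⟨v, hv⟩ := (FractionalIdeal.mem_one_iff _).mp h2
    rw [← hv]; exact v.2
  have hxinvO : ((x⁻¹ : Kˣ) : K) ∈ quadOrder K c := by
    have h2 : (1 : K) ∈ FractionalIdeal.spanSingleton (quadOrder K c)⁰ (x : K) := by
      rw [hx1]; exact FractionalIdeal.one_mem_one _
    obtain ⟨v, hv⟩ := (FractionalIdeal.mem_spanSingleton _).mp h2
    have h3 : (v : K) = ((x⁻¹ : Kˣ) : K) := by
      rw [Algebra.smul_def] at hv
      rw [Units.val_inv_eq_inv_val]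
      exact eq_inv_of_mul_eq_one_left hv
    rw [← h3]; exact v.2
  let xu : (quadOrder K c)ˣ :=
    ⟨⟨x, hxO⟩, ⟨((x⁻¹ : Kˣ) : K), hxinvO⟩, Subtype.ext x.mul_inv, Subtype.ext x.inv_mul⟩
  have hxpm : (x : K) = 1 ∨ (x : K) = -1 := coe_units_quadOrder_eq_one_or_eq_neg_one hK hc2 xu
  have hmem : (1 : K) + ((k' * c : ℤ) : K) * omega b ∈
      (kerUnit b hb hpc hd k : FractionalIdeal (quadOrder K d)⁰ K) := by
    have h0 : (1 : K) + ((k' * c : ℤ) : K) * omega b ∈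
        (kerUnit b hb hpc hd k' : FractionalIdeal (quadOrder K d)⁰ K) := one_add_mem_kerFrac h
    rw [← hx, Units.val_mul, coe_toPrincipalIdeal, mul_comm] at h0
    obtain ⟨y', hy', hyeq⟩ := FractionalIdeal.mem_singleton_mul.mp h0
    rcases hxpm with h1 | h1
    · rw [hyeq, h1, one_mul]; exact hy'
    · rw [hyeq, h1, neg_one_mul]; exact Submodule.neg_mem _ hy'
  obtain ⟨u, hu, r, hr, hdec⟩ := (mem_kerFrac_iff h).mp hmem
  obtain ⟨U, V, hV, rfl⟩ := (mem_quadOrder_iff_coords b hb).mp hu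
  obtain ⟨R, S, hS, rfl⟩ := (mem_quadOrder_iff_coords b hb).mp hr
  have e := coords_mul b hb U V 1 (k * c)
  have hfinal : ((1 : ℤ) : K) + ((k' * c : ℤ) : K) * omega b =
      ((U * 1 + V * (k * c) * mConst b + p * R : ℤ) : K) +
        ((U * (k * c) + 1 * V + V * (k * c) * tConst b + p * S : ℤ) : K) * omega b := by
    push_cast at hdec e ⊢
    linear_combination hdec + e
  obtain ⟨h1, h2⟩ := coords_unique b hb hfinal
  obtain ⟨v, rfl⟩ := hV
  obtain ⟨s', rfl⟩ := hS
  have hc0 : (c : ℤ) ≠ 0 := by exact_mod_cast NeZero.ne c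
  subst hd
  push_cast at h1 h2
  have h2' : k' = U * k + p * v + p * v * (k * c) * tConst b + p * s' := by
    apply mul_left_cancel₀ hc0
    linear_combination h2
  exact ⟨k * (-(c * v * k * c * mConst b) - R) + (v + v * (k * c) * tConst b + s'),
    by linear_combination h2' - k * h1⟩

include hb in
/-- The classes `[𝔞_0], …, [𝔞_{p−1}]` are pairwise distinct. [cite: Cox2013, §7.D Thm. 7.24 (7.25)–(7.27), Cor. 7.28] -/
theorem mk_kerUnit_injOn (hK : IsImaginaryQuadratic K) (hpc : p ∣ c) (hd : d = c * p) :
    Set.InjOn (fun k : ℕ => ClassGroup.mk K (kerUnit b hb hpc hd k)) (Finset.range p : Set ℕ) := by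
  intro k hk k' hk' he
  have hk : k < p := by simpa using hk
  have hk' : k' < p := by simpa using hk'
  have hdvd := dvd_sub_of_mk_kerUnit_eq hb hK hpc hd he
  have : (k : ℤ) = k' := by
    rcases hdvd with ⟨j, hj⟩
    have hj0 : j = 0 := by
      rcases lt_trichotomy j 0 with hj' | hj' | hj'
      · nlinarith
      · exact hj'
      · nlinarith
    rw [hj0, mul_zero, sub_eq_zero] at hj
    exact hj.symm
  exact_mod_cast this

end Kernel

/-! ### §6 Consequences: finiteness and the fibre sum -/

section Fibre

variable {c d : ℕ} [NumberField K] [NeZero c] [NeZero d] {b : Basis (Fin 2) ℤ (𝓞 K)} (hb : b 0 = 1)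
  {p : ℕ} [hp : Fact p.Prime]

include hb in
/-- **The fibres of `Pic(𝒪_{cp}) → Pic(𝒪_c)`**: the fibre through `σ₀` is `{[𝔞_k] σ₀ : 0 ≤ k < p}`. [cite: BertoliniDarmon1996, §2.3] -/
theorem filter_picRes_eq_image [Fintype (ClassGroup (quadOrder K d))]
    [DecidableEq (ClassGroup (quadOrder K c))] [DecidableEq (ClassGroup (quadOrder K d))]
    (hpc : p ∣ c) (hd : d = c * p) (σ₀ : ClassGroup (quadOrder K d)) :
    (Finset.univ.filter fun σ => picRes K (Dvd.intro p hd.symm) σ = picRes K (Dvd.intro p hd.symm) σ₀) =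
      (Finset.range p).image fun k : ℕ => ClassGroup.mk K (kerUnit b hb hpc hd (k : ℤ)) * σ₀ := by
  ext σ
  simp only [Finset.mem_filter, Finset.mem_univ, true_and, Finset.mem_image, Finset.mem_range]
  constructor
  · intro hσ
    have h1 : picRes K (Dvd.intro p hd.symm) (σ * σ₀⁻¹) = 1 := by
      rw [map_mul, map_inv, hσ, mul_inv_cancel]
    obtain ⟨k, hk, hkσ⟩ := exists_eq_mk_kerUnit_of_picRes_eq_one hb hpc hd h1
    exact ⟨k, hk, by rw [← hkσ, inv_mul_cancel_right]⟩
  · rintro ⟨k, -, rfl⟩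
    rw [map_mul, picRes_mk_kerUnit, one_mul]

include hb in
/-- **Fibre sum**: `∑_{res σ = res σ₀} F σ = ∑_{k < p} F([𝔞_k] σ₀)` (`K` imaginary quadratic). [cite: BertoliniDarmon1996, §2.3] -/
theorem sum_filter_picRes_eq_sum_range {M : Type*} [AddCommMonoid M] [Fintype (ClassGroup (quadOrder K d))]
    [DecidableEq (ClassGroup (quadOrder K c))]
    (hK : IsImaginaryQuadratic K) (hpc : p ∣ c) (hd : d = c * p) (σ₀ : ClassGroup (quadOrder K d))
    (F : ClassGroup (quadOrder K d) → M) :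
    ∑ σ ∈ Finset.univ.filter (fun σ => picRes K (Dvd.intro p hd.symm) σ = picRes K (Dvd.intro p hd.symm) σ₀),
      F σ = ∑ k ∈ Finset.range p, F (ClassGroup.mk K (kerUnit b hb hpc hd k) * σ₀) := by
  classical
  rw [filter_picRes_eq_image hb hpc hd σ₀, Finset.sum_image fun k hk k' hk' he =>
    mk_kerUnit_injOn hb hK hpc hd hk hk' (mul_right_cancel he)]

include hb in
/-- **Each fibre has exactly `p` elements.** [cite: BertoliniDarmon1996, §2.3] -/
theorem card_filter_picRes_eq [Fintype (ClassGroup (quadOrder K d))] [DecidableEq (ClassGroup (quadOrder K c))]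
    (hK : IsImaginaryQuadratic K) (hpc : p ∣ c) (hd : d = c * p) (σ₀ : ClassGroup (quadOrder K d)) :
    (Finset.univ.filter fun σ =>
      picRes K (Dvd.intro p hd.symm) σ = picRes K (Dvd.intro p hd.symm) σ₀).card = p := by
  classical
  rw [filter_picRes_eq_image hb hpc hd σ₀, Finset.card_image_of_injOn fun k hk k' hk' he =>
    mk_kerUnit_injOn hb hK hpc hd hk hk' (mul_right_cancel he), Finset.card_range]

/-- **`Pic(𝒪_{cp})` is finite iff `Pic(𝒪_c)` is** (`K` quadratic, `p ∣ c` prime): the map is onto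
with finite fibres. (Both are in fact finite; this relative statement is what the tower needs.) [cite: BertoliniDarmon1996, §2.3] -/
theorem finite_classGroup_iff (h2 : Module.finrank ℚ K = 2) (hpc : p ∣ c) (hd : d = c * p) :
    Finite (ClassGroup (quadOrder K d)) ↔ Finite (ClassGroup (quadOrder K c)) := by
  constructor
  · intro _
    exact Finite.of_surjective _ (picRes_surjective h2 hpc hd)
  · intro hfin
    obtain ⟨b, hb⟩ := exists_basis_zero_eq_one (K := K) h2
    haveI := hfin
    let s := Function.surjInv (picRes_surjective (K := K) h2 hpc hd)
    refine Finite.of_surjective (fun τk : ClassGroup (quadOrder K c) × Fin p =>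
      ClassGroup.mk K (kerUnit b hb hpc hd (τk.2 : ℕ)) * s τk.1) fun σ => ?_
    have hσ : picRes K (Dvd.intro p hd.symm) (σ * (s (picRes K (Dvd.intro p hd.symm) σ))⁻¹) = 1 := by
      rw [map_mul, map_inv, Function.surjInv_eq (picRes_surjective (K := K) h2 hpc hd), mul_inv_cancel]
    obtain ⟨k, hk, hkσ⟩ := exists_eq_mk_kerUnit_of_picRes_eq_one hb hpc hd hσ
    exact ⟨(picRes K (Dvd.intro p hd.symm) σ, ⟨k, hk⟩), by simp only; rw [← hkσ, inv_mul_cancel_right]⟩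

end Fibre


end QuadOrderTower

end Literature.NumberTheory.EllipticCurves

end
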